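import Summits.NavierStokesRegularity.NavierStokesRegularity.Theses.TypeICertificateLadder
import Summits.NavierStokesRegularity.NavierStokesRegularity.Theorems.TypeICertificateLadderNoTypeIBlowupLocal
import Summits.NavierStokesRegularity.NavierStokesRegularity.Theorems.TypeICertificateLadderNoTypeIBlowupTypeIMorrey
import Literature.Analysis.FluidPDE.KNSSTypeIIHolds
import Literature.Analysis.FluidPDE.NSLerayBlowupRateTopHolds
import Literature.Analysis.FluidPDE.NSCriticalClosureProofs
import Literature.Analysis.FluidPDE.TaoLocalisationHolds
import Literature.Analysis.FluidPDE.ClassicalSuitable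
import Literature.Analysis.FluidPDE.AxisymmetricTypeIAxis
import Literature.Analysis.FluidPDE.KNSSAxisymmetricNoSwirl
import Literature.Analysis.FluidPDE.SereginSverak2002PressureLowerBoundProofs
import Literature.Analysis.FluidPDE.NSLerayHopfABCScaling
import Literature.Analysis.FluidPDE.ClassicalSolutionRescale
import Literature.Analysis.FluidPDE.LerayHopfNSRescale
import Literature.Barriers.NavierStokesRegularity.AxisymmetricTypeIExclusion
import Literature.Barriers.NavierStokesRegularity.AxisymmetricTypeIExclusionHolds
import Literature.Analysis.FluidPDE.KNSSNoAxisymmetricTypeIHolds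
import Literature.Barriers.NavierStokesRegularity.LeraySelfSimilarBlowupExclusionProofs
import Literature.Analysis.FluidPDE.ConstantinDirectionDissipationProofs
import Literature.Analysis.FluidPDE.ChaeWolfRemovingDSSProofs
import Literature.Barriers.NavierStokesRegularity.NavierStokesInequalitySingularSolutionHolds
import Literature.Barriers.NavierStokesRegularity.SchefferSwitchedSolution
import Literature.Barriers.NavierStokesRegularity.SchefferSwitchedSingular
import Literature.Barriers.NavierStokesRegularity.SchefferSwitchedIntegrability
import Literature.Barriers.NavierStokesRegularity.SchefferSwitchedField
import Literature.Analysis.FluidPDE.NSQuasipotential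
import Literature.Analysis.FluidPDE.LerayLocalRegularH1Proofs

/-!
# Disproof work file — crux `Target` = `TypeICertificateLadder.NoTypeIBlowup`
# (item stmt-NavierStokesRegularity-1217; shared as `ThreadingFlux.Target`, `CoreLogGas.NoTypeIBlowup`, …)

Standing adversary, generation 2 (refuter-cdisprove-stmt-NavierStokesRegularity-1217-g2-0,
2026-08-15) and generation 3 (…-g3-0, 2026-08-16: §§7–8, and the landing of §§1–3, 7 on the
`Theorems/Target/Negative/` lane). Everything below is `lean check`ed, sorry-free, standard axioms.

The crux: for `ν > 0`, `T > 0`, a classical solution `(u, p)` of unforced Navier–Stokes on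
`ℝ³ × [0, T)` which is Leray–Hopf on `[0, T]` from the rapidly decaying datum `u 0` and obeys the
Type-I rate `‖u(t, x)‖ ≤ C / √(T - t)` for `t ↑ T` has a classical extension past `T`.

## Landed, importable (gen 3; `Summits/…/Theorems/Target/Negative/`, all `--supports` stmt-1217)
`EnergyClassLoadBearing` (§§1–2b, p74663), `LocalPressureLoadBearing` (§3, p74953),
`ClassicalClauseLoadBearing` (§8, p75001), `NSIModelFalse` (§7, p74722), `CounterexampleProfile`
(§§4, 4b, p75541), `NormalForms` (§§5, 6, p76639), `KillNormalForm` (§§6b, 6c, p77235) — all ACCEPTED 2026-08-16; same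
declaration names in namespace `Summit.NavierStokesRegularity.NavierStokesRegularity.Theorems.Target.Negative`.

## Findings (index)

* §1 `isClassicalNSSolutionOn_uniform` — the parasitic family: EVERY spatially uniform flow
  `u(t, x) = a(t) e` with the linear pressure `p(t, x) = -a'(t) ⟪e, x⟫` is a classical solution,
  for every viscosity (Serrin's / KNSS's `b(t)` examples).
* §2 LOAD-BEARING (Leray–Hopf clause): `target_false_without_lerayHopf` — with `IsLerayHopfOn`
  deleted the statement is FALSE: `a(t) = -log(1 - t)`, `e = e₀`, `T = 1` is classical on `[0, 1)`,
  has datum `0` (rapid decay), Type-I constant `2`, and no classical extension (`‖u(t, 0)‖ → ∞`).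
  §2b `target_false_without_energy`: the drift flow is even a WEAK solution
  (`isWeakNSSolutionOn_uniform`: every uniform flow with measurable, locally-`L²`-in-time
  amplitude is a pressure-free weak solution — solenoidal tests have zero mean), so replacing
  `IsLerayHopfOn` by its first field `IsWeakNSSolutionOn` is still FALSE: of the Leray–Hopf bundle
  only the finite-energy clauses are load-bearing. (Gen-1 had both results as evidence only; they
  now live in the tree.)
* §3 LOAD-BEARING FOR THE PROVERS' REDUCTION: the tree theorem
  `Theorems.noTypeIBlowup_of_local_typeI_regularity` reduces the crux to the local statement
  `LocalTypeIRegularity` (Seregin–Šverák 2009 Thm 3.1 without axial symmetry: distributional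
  solution in `Q = 𝒞 × ]-1,0[`, `v ∈ L³(Q)`, `π ∈ L^{3/2}(Q)`, a.e. rate `√(-s)|v| ≤ C` ⟹ bounded
  near the vertex). `localTypeIRegularity_false_without_pressure`: deleting ONLY the clause
  `π ∈ L^{3/2}(Q)` makes it FALSE — the same drift flow in the variables `s = t - 1`
  (`v(s, y) = -log(-s) e₀`, `π(s, y) = -⟪a'(s) e₀, y⟫`) is distributional in `Q`, lies in `L³(Q)`,
  has the a.e. Type-I rate with constant `2`, and is essentially unbounded on every `Q_r(0, 0)`.
  So any proof of the local statement must use the pressure integrability (equivalently the local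
  energy bounds it buys, SS 2009 Lemma 3.5); `target_of_localTypeIRegularity` re-exports the
  provers' reduction for reference.
* §4 PROFILE OF A COUNTEREXAMPLE (consequences of PROVED tree theorems, no named facts):
  a counterexample `(ν, T, u, p)` to the crux is a maximal smooth solution
  (`counterexample_isMaximal`); it IS the Kato `C_t L³` mild solution from its datum, with maximal
  time `T` (`counterexample_isKato`, `counterexample_kato_maximal` — the weak–strong identification),
  and it has a singular POINT `(T, x₀)`, `‖u‖_{L^∞(Q_r(T,x₀))} = ∞` for all small `r`
  (`counterexample_singular_point`, Lemarié-Rieusset Thm 15.1 (C)); it is NOT bounded on `[0, T) × ℝ³` (`counterexample_unbounded`,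
  from `hasSmoothExtensionPast_of_bounded_holds`, RRS 2016 Thm 8.17); it IS essentially bounded on
  every earlier slab `[0, T'] × ℝ³`, `T' < T` (`counterexample_bounded_before`, Tao 2013 via
  `tao2011_hasBoundedSobolevNormsOn_holds`) — so the singularity sits exactly at `T`; it obeys
  Leray's lower rate `‖u(t)‖_∞ ≥ c √ν / √(T - t)` for ALL `t ∈ [0, T)` with Leray's universal `c`
  (`counterexample_leray_lower_bound`, from `leray_blowup_rate_top_holds`), hence every admissible
  Type-I constant satisfies `c √ν ≤ C` (`counterexample_typeI_constant_ge`): in the normal form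
  `ν = 1` the counterexample search has ONE dimensionless parameter `C ≥ c_Leray` (this is the
  content of the route's `RungZero`, stmt-…-2886, seen from the negative side); and the blow-up
  happens AT `T`: `limsup_{t ↑ T} ‖u(t)‖_∞ = ∞` (`counterexample_blowup_at_T`: for all `M` and
  `T' < T` some `t ∈ (T', T)`, `x` with `‖u(t, x)‖ > M`); `pointwise_bounded_before` upgrades the
  slab bound to a POINTWISE bound on every `[0, T'] × ℝ³` (joint continuity + positive-measure
  box), which is the sub-slab hypothesis of the tree's axisymmetric theorem, whence
  `target_axisymmetric` / `counterexample_not_axisymmetric`: THE AXISYMMETRIC CASE OF THE CRUX IS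
  PROVED (KNSS 2009 Thms 6.1–6.2 / SS 2009 Thm 1.1, discharged in the tree as
  `knss_no_axisymmetric_typeI_holds`; standard axioms) — a counterexample is not axisymmetric;
  likewise the axisymmetric case of the local statement is the discharged barrier
  `AxisymmetricTypeIExclusion_holds` (`localTypeIRegularity_axisymmetric`); and
  `target_selfSimilar`: a solution coinciding near `T` with Leray's EXACT backward self-similar
  ansatz (C² profile) extends — NRŠ 1996 / Tsai 1998 Thm 2, discharged in the tree as
  `LeraySelfSimilarBlowupExclusion_holds`, fed with the Leray–Hopf energy and the classical-gradient
  dissipation; so a counterexample is not exactly self-similar either (standard axioms); and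
  `target_dss_near_one`: a solution coinciding near `T` with (the time shift of) an ancient
  classical `λ`-DSS solution with Type-I decay constant `C₀` extends whenever `1 < λ < λ₁(C₀)` —
  Chae–Wolf 2017 Thm 1.3, discharged in the tree as `chaeWolf2017_removing_dss_holds`; a DSS-type
  counterexample needs `λ ≥ λ₁(C₀)` (the open wall `TypeIDSSLiouvilleConjecture`).
* §4b WHAT A KILL MUST CONTAIN (gen 3): `localTypeISingularityExists_of_not_target` — a
  counterexample yields an Albritton–Barker local Type-I singular point (registered OPEN
  statement `LocalTypeISingularityExists`; unconditional contrapositive of the provers' landed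
  `noTypeIBlowup_of_not_localTypeISingularityExists`); modulo `AlbrittonBarkerForward` it yields
  `NontrivialMildAncientTypeIExists`, and modulo its measurable-slice form it REFUTES the KNSS
  Liouville conjecture `LiouvilleConjectureNS` (`not_liouvilleConjectureNS_of_not_target`):
  killing the crux is at least as hard as disproving (L).
* §5 NOT load-bearing: `0 < T` (`hasSmoothExtensionPast_of_nonpos`, `targetWithoutTpos_iff`).
* §6 NORMAL FORM `target_iff_unit : Target ↔ TargetAt 1 1`: viscosity normalisation
  (`targetAt_of_viscosity_one`, Tao 2013 fn. 3, constant `C ↦ C/√ν`) and Leray's similarity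
  (`targetAt_one_of_unit`, constant invariant) transport all five clauses AND the conclusion
  (the extension is scaled back); provers may assume `ν = T = 1`, and with §4 the counterexample
  search has exactly one dimensionless parameter `C ≥ c_Leray`. Helper:
  `hasRapidSpatialDecay_nsRescaleData` (Schwartz decay is dilation invariant).
* §7 MODEL REFUTATION (gen 3) `targetNSI_false`: the Navier–Stokes-INEQUALITY analogue of the
  crux is FALSE — Scheffer's 1985 switched field (tree: sorry-free discharge
  `NSIBlockExists_holds`, `isWeakNSISolution_glue`, `not_isRegularPoint_glue`) is a finite-energy
  weak NSI solution (energy class, `∇u ∈ L²`, solenoidal, pressure formula, local energy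
  inequality for every `ν ∈ [0, ν₀]`), with `C^∞` compactly supported slices at ALL times, from a
  smooth compactly supported (hence rapidly decaying) datum, and — NEW, `isTypeIBlowup_glue` — it
  blows up at its singular time `T₀ = T/(1-τ²)` exactly at the TYPE-I RATE
  (`√(T₀ - t)‖𝔲(t)‖_∞ ≤ M√T₀`: magnitude `τ^{-j}` on the `j`-th piece, remaining life `τ^{2j}T₀`),
  yet `(T₀, x₀)` is singular (`exists_nsi_typeI_singular`). So finite energy + local energy
  inequality + Type-I rate + smooth slices do NOT force regularity: a proof of the crux must use
  the EQUATION `f = 0` (vorticity equation / backward uniqueness / unique continuation / the exact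
  Leray profile equation) or the time-regularity of classical solutions on `[0, T)` (Scheffer's
  field jumps DOWN in magnitude at the switching times `t_j ↑ T₀`) — CKN-type ε-regularity, which
  holds verbatim for NSI solutions (Ożański 2020 p. 3), cannot distinguish. Complements §2
  (there the energy class was missing; here it is present and still insufficient).
* §8 (gen 3) `target_hypotheses_satisfiable` — NON-VACUITY: the rest state meets all four
  hypotheses (and extends); with §4 the hypotheses are met exactly by bounded solutions (which
  extend) and by genuine Type-I singularities (the open question) — no junk third way.
  `target_false_without_classical` — with the CLASSICAL clause deleted the statement is FALSE
  (spiked rest state: `e₀` on the null line `x = 0`, `t > 0`; Leray–Hopf from rest via the tree's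
  `isLerayHopfOn_zero` + `IsLerayHopfOn.congr_ae_slices`, bounded hence Type-I, no classical
  extension because `HasSmoothExtensionPast` demands POINTWISE agreement): misstated-type — the
  classical clause is what fixes the continuous representative; weak/mild-class arguments must be
  brought back to the pointwise `u` (§4 `pointwise_bounded_before`).
* §6b (gen 3) `target_iff_globalRate : Target ↔ TargetGlobalRate` — the eventual rate
  hypothesis may be replaced by the rate on ALL of `[0, T)` (`globalRate_of_isTypeIBlowup`:
  eventual rate on `(T₁, T)` + pointwise bound `M` on `[0, T']` ⇒ constant `max C (M√T)`);
  provers may start from `∀ t ∈ [0, T), ‖u(t)‖_∞ ≤ C/√(T - t)` and `ν = T = 1` (§6).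
* §6c (gen 3) `not_target_iff_unit_witness` — THE ADVERSARY'S NORMAL FORM: `¬Target` iff some
  classical unit-viscosity `(u, p)` on `[0, 1) × ℝ³`, Leray–Hopf from its rapidly decaying datum,
  with the Type-I rate on ALL of `[0, 1)`, has no classical extension past `1`.
* WHY IT RESISTS (paper analysis, agreeing with gen-1 §3): with the Leray–Hopf clause the velocity
  is pinned to the mild solution from the Schwartz datum (weak–strong uniqueness; the pressure
  gauge is free but irrelevant), the mild solution is bounded on every `[0, T']` (§4), and a
  failure to extend is a genuine singular point at time `T` (far-field regularity); so the crux is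
  EQUIVALENT to Type-I exclusion for mild solutions from Schwartz data — open beyond axisymmetry
  (KNSS 2009; Seregin–Šverák 2009), self-similar (NRŠ 1996, Tsai 1998) and λ-DSS with λ near 1
  (Chae–Wolf 2017). No finite or small model exists; every explicit family tried (uniform drift,
  potential flows, shear/2½-D flows, Beltrami fields, Serrin's `a(t)∇h`, backward self-similar
  `(-s)^{-1/2} V`) is excluded by finite energy resp. by `L³ × L^{3/2}` locally (§§2–3).
  The mutations that ARE cheaply separable are exactly §2 (energy class) and §3 (pressure class).

LITERATURE TRIAGE (gen 3, 2026-08-16; zbMATH only — OpenAlex/S2/arXiv rate-limited, searchd down):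
  no finite-energy Type-I singularity is in print. (i) arXiv:2604.09949 (R. Shahmurov, Apr 2026,
  unrefereed): claims "stable nearly self-similar" blow-up of 3D NS on `𝕋³` for `ν < 0.00582` via a
  computer-assisted axisymmetric-with-swirl profile — but its ansatz (§4.1 there:
  `Ω = (T*-t)⁻¹ Ω̄(r/√(T*-t), z/√(T*-t))`, `b = (T*-t)^{-1/2} b̄`) is EXACTLY Leray's backward
  self-similar one, in the axisymmetric class: excluded twice by discharged tree theorems —
  `target_selfSimilar` (NRŠ 1996 / Tsai 1998, local-energy form) and `target_axisymmetric` (KNSS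
  2009 / SS 2009); a viscosity threshold is moreover scaling-inconsistent. NOT a counterexample
  candidate. (ii) Pineau–Vicol arXiv:2607.09619 (Jul/Aug 2026): Liouville theorems for ROTATED
  (discretely) self-similar profiles under a Type-I bound for extreme rotation speeds `α` (and
  `λ` near `1`), and a one-slice criterion (Thm 1.9, in tree DISCHARGED as
  `pineauVicol2026_oneSlice_regularity_holds`): Type-I in a parabolic cylinder + approximately
  self-similar at ONE late slice ⇒ regular — further shrinks the room for a counterexample
  (not formalised in §4: its Type-I hypothesis is the space–time form `C/(√(-t)+|x|)`).
  (iii) Q. S. Zhang arXiv:2604.07785 (2026): partial Type-I ⇒ regularity in the axisymmetric class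
  (calibration class, consistent). (iv) Seregin arXiv:2507.08733 (2025): Type-II scenarios (not
  Type I). (v) Cheskidov–Dai–Palasek arXiv:2511.09556 (2025): instantaneous Type-I blow-up from the
  RIGHT on `𝕋^d`, outside the Leray–Hopf class (tree barrier `InstantaneousTypeIBlowup`) — not a
  finite-time Type-I singularity. (vi) Barker, Proc. AMS B 11 (2024), arXiv:2111.14776: under a
  Type-I bound the blow-up time carries finitely many singular points (structure, cf. §4).
  (vii) Wang–Bennani–Martens–… arXiv:2509.14185 (2025, PINN "unstable singularities") and Hou–Wang
  Nonlinearity 37 (2024): models / Euler-with-boundary / Boussinesq, not 3D NS.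

RECEIVED FROM THE TRIAGE PANEL (round 1, `TRIAGE-r1-*.md`, hand derivations, NOT Lean-checked
here): (a) every rung `X_C` with `C < √ν` (normal form `C < 1`) is elementary — enstrophy
Grönwall `d/dt ‖∇u‖₂² ≤ ‖u(t)‖²_∞ ‖∇u‖₂²/(2ν)` (tree: `lintegral_frobeniusNormSq_fderiv_le_mul_exp`,
constant-`M` form; chain it on a geometric partition of `[t₀, T)`) against Leray's `H¹` rate
`‖∇u(t)‖₂² ≳ ν^{3/2}(T−t)^{-1/2}` (local `H¹` theory, tree: `leray_local_regular_H1_holds`, lifespan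
`≥ cν³/‖∇u₀‖⁴`) gives exponents `C²/(2ν) < 1/2` vs `1/2`, a contradiction independent of all
constants; r1-3 reports the free range up to `C < (√6−√2)√ν ≈ 1.035√ν` via an `L^{5/2}` variant.
So the dimensionless parameter of a counterexample satisfies `C/√ν ≥ 1` (indeed `≥ 1.035`), which
SHARPENS `counterexample_typeI_constant_ge` below (stated with Leray's existential `c`); a Lean proof
along these lines is rung business (items stmt-…-2886 `RungZero`, stmt-…-2882 `RungReynoldsOne`).
(b) Profile-side search constraints for RSS/soliton-modelled candidates (conjugate-density moments
`⟨|y|²⟩_m > 6`, `⟨|∇ψ|²⟩_m = ¼⟨|y|²⟩_m − 3/2`, `⟨Ω·SΩ⟩_m ≥ ⟨|Ω|²⟩_m`; soliton enstrophy law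
`∫|Ω|² m_α ≤ 4α²`) — recorded, not formalised (they concern ancient profile objects, not the crux's
finite-energy class).

Gen-1's work file (76 decls; evidence `20260815T224123Z-Disproof.lean` on the item) is not
readable from this seat's jail (run/gate not mounted); its content is known from the evidence
notes only and is deliberately not duplicated beyond §2.
-/

noncomputable section

open MeasureTheory TopologicalSpace Set Function Filter Metric
open scoped Topology RealInnerProductSpace ContDiff Laplacian InnerProductSpace
open Literature.Analysis.FluidPDE Literature.Barriers.NavierStokesRegularity

namespace Summit.NavierStokesRegularity.NavierStokesRegularity.Cruxes.Target.Disproof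

set_option linter.dupNamespace false

/-- Local notation for physical space `ℝ³ = EuclideanSpace ℝ (Fin 3)`. -/
local notation "ℝ³" => EuclideanSpace ℝ (Fin 3)

/-- The crux under attack, by name (item stmt-NavierStokesRegularity-1217). -/
abbrev Target : Prop :=
  Summit.NavierStokesRegularity.NavierStokesRegularity.Theses.TypeICertificateLadder.NoTypeIBlowup

/-- Sanity: `Target` is literally the route decl. -/
example : Target ↔
    Summit.NavierStokesRegularity.NavierStokesRegularity.Theses.TypeICertificateLadder.NoTypeIBlowup :=
  Iff.rfl

/-! ## §1 The parasitic family: spatially uniform pressure-driven flows -/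

section Uniform

variable {E : Type*} [NormedAddCommGroup E] [InnerProductSpace ℝ E]

/-- Spatially uniform velocity `u(t, x) = a(t) e`. -/
def uniformVel (a : ℝ → ℝ) (e : E) : ℝ → E → E := fun t _ => a t • e

/-- The linear pressure `p(t, x) = ⟪-b(t) e, x⟫ = -b(t) ⟪e, x⟫` driving the uniform flow
(`b = a'`). -/
def uniformPres (b : ℝ → ℝ) (e : E) : ℝ → E → ℝ := fun t x => ⟪(-b t) • e, x⟫

@[simp] theorem uniformVel_apply (a : ℝ → ℝ) (e : E) (t : ℝ) (x : E) :
    uniformVel a e t x = a t • e := rfl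

@[simp] theorem uniformPres_apply (b : ℝ → ℝ) (e : E) (t : ℝ) (x : E) :
    uniformPres b e t x = ⟪(-b t) • e, x⟫ := rfl

variable [FiniteDimensional ℝ E]

/-- The gradient of `y ↦ ⟪v, y⟫` is `v`. -/
theorem hasGradientAt_inner_left (v x : E) : HasGradientAt (fun y : E => ⟪v, y⟫) v x := by
  rw [hasGradientAt_iff_hasFDerivAt]
  have h := (InnerProductSpace.toDual ℝ E v).hasFDerivAt (x := x)
  have hfun : (fun y : E => ⟪v, y⟫) = ⇑(InnerProductSpace.toDual ℝ E v) := by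
    funext y
    exact (InnerProductSpace.toDual_apply_apply).symm
  rw [hfun]
  exact h

theorem gradient_uniformPres (b : ℝ → ℝ) (e : E) (t : ℝ) (x : E) :
    gradient (uniformPres b e t) x = (-b t) • e :=
  (hasGradientAt_inner_left ((-b t) • e) x).gradient

omit [FiniteDimensional ℝ E] in
/-- Constant fields are divergence free. -/
theorem isDivFree_const (c : E) : VectorCalculus.IsDivFree (fun _ : E => c) := fun x => by
  show LinearMap.trace ℝ E (fderiv ℝ (fun _ : E => c) x : E →ₗ[ℝ] E) = 0
  simp

variable {S : Set ℝ} {a : ℝ → ℝ}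

/-- **Every spatially uniform flow is a classical Navier–Stokes solution** on any time set of
unique differentiability, for every viscosity `ν`, with the linear pressure
`p = ⟪-(a') e, x⟫` (`a'` the one-sided derivative within `S`): `∂ₜu = a' e = -∇p`,
`(u·∇)u = 0`, `Δu = 0`, `div u = 0`. This is the parasitic family `u = b(t)` of
Koch–Nadirashvili–Seregin–Šverák 2009, §1 p. 3, and the `h ≡ ⟪e, x⟫` case of Serrin's
`a(t)∇h(x)`. -/
theorem isClassicalNSSolutionOn_uniform (hS : UniqueDiffOn ℝ S) (ha : ContDiffOn ℝ ∞ a S)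
    (ν : ℝ) (e : E) :
    IsClassicalNSSolutionOn S ν 0 (uniformVel a e) (uniformPres (derivWithin a S) e) where
  smooth_velocity := by
    have h1 : ContDiffOn ℝ ∞ (fun z : ℝ × E => a z.1) (S ×ˢ univ) :=
      ha.comp contDiffOn_fst fun z hz => (mem_prod.1 hz).1
    show ContDiffOn ℝ ∞ (fun z : ℝ × E => a z.1 • e) (S ×ˢ univ)
    exact h1.smul contDiffOn_const
  smooth_pressure := by
    have hb : ContDiffOn ℝ ∞ (derivWithin a S) S := ((contDiffOn_infty_iff_derivWithin hS).1 ha).2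
    have h1 : ContDiffOn ℝ ∞ (fun z : ℝ × E => (-(derivWithin a S z.1)) • e) (S ×ˢ univ) :=
      ((hb.comp contDiffOn_fst fun z hz => (mem_prod.1 hz).1).neg).smul contDiffOn_const
    show ContDiffOn ℝ ∞ (fun z : ℝ × E => ⟪(-(derivWithin a S z.1)) • e, z.2⟫) (S ×ˢ univ)
    exact h1.inner ℝ contDiffOn_snd
  momentum t ht x := by
    have hdiff : DifferentiableWithinAt ℝ a S t := (ha.differentiableOn (by simp)) t ht
    have h1 : timeDerivWithin S (uniformVel a e) t x = derivWithin a S t • e := by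
      rw [timeDerivWithin_apply]
      show derivWithin (fun s => a s • e) S t = derivWithin a S t • e
      exact derivWithin_smul_const hdiff e
    have h2 : convect (uniformVel a e t) (uniformVel a e t) x = 0 := by
      show fderiv ℝ (fun _ : E => a t • e) x (a t • e) = 0
      simp
    have h3 : Δ (uniformVel a e t) x = 0 := by
      show Δ (fun _ : E => a t • e) x = 0
      rw [InnerProductSpace.laplacian_const]; rfl
    rw [h1, h2, h3, gradient_uniformPres]
    simp
  divFree t _ := isDivFree_const (a t • e)

end Uniform

/-! ## §2 The drift flow `u = -log(1 - t) e₀`: the Leray–Hopf clause is load-bearing -/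

section Drift

/-- The unit vector `e₀`. -/
def e₀ : ℝ³ := EuclideanSpace.single 0 1

@[simp] theorem norm_e₀ : ‖e₀‖ = 1 := by simp [e₀]

/-- `-log y ≤ y^{-ε} / ε` for `0 < y` (from Mathlib's `log x ≤ x^ε / ε` at `x = y⁻¹`). -/
theorem neg_log_le_rpow_div {y ε : ℝ} (hy : 0 < y) (hε : 0 < ε) :
    -Real.log y ≤ y ^ (-ε) / ε := by
  have h := Real.log_le_rpow_div (inv_nonneg.2 hy.le) hε
  rwa [Real.log_inv, Real.inv_rpow hy.le, ← Real.rpow_neg hy.le] at h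

/-- `-log y ≤ 2 / √y` for `0 < y`. -/
theorem neg_log_le_two_div_sqrt {y : ℝ} (hy : 0 < y) : -Real.log y ≤ 2 / Real.sqrt y := by
  have h := neg_log_le_rpow_div hy (by norm_num : (0 : ℝ) < 1 / 2)
  rw [Real.rpow_neg hy.le, ← Real.sqrt_eq_rpow] at h
  calc -Real.log y ≤ (Real.sqrt y)⁻¹ / (1 / 2) := h
    _ = 2 / Real.sqrt y := by ring

/-- `√y · (-log y) ≤ 2` for `0 < y`: the drift amplitude obeys the Type-I rate with constant `2`. -/
theorem sqrt_mul_neg_log_le_two {y : ℝ} (hy : 0 < y) : Real.sqrt y * (-Real.log y) ≤ 2 := by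
  have h := neg_log_le_two_div_sqrt hy
  have hs : 0 < Real.sqrt y := Real.sqrt_pos.2 hy
  calc Real.sqrt y * (-Real.log y) ≤ Real.sqrt y * (2 / Real.sqrt y) :=
        mul_le_mul_of_nonneg_left h hs.le
    _ = 2 := by field_simp

/-- The drift amplitude `a(t) = -log(1 - t)`: `a(0) = 0`, smooth on `t < 1`, `a(t) ↑ ∞` as `t ↑ 1`. -/
def driftAmp (t : ℝ) : ℝ := -Real.log (1 - t)

/-- The drift flow `u(t, x) = -log(1 - t) e₀`. -/
def driftVel : ℝ → ℝ³ → ℝ³ := uniformVel driftAmp e₀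

/-- Its pressure `p(t, x) = ⟪-a'(t) e₀, x⟫` (`a'` within `[0, 1)`; `= -(1 - t)⁻¹ x₀` there). -/
def driftPres : ℝ → ℝ³ → ℝ := uniformPres (derivWithin driftAmp (Ico 0 1)) e₀

theorem contDiffOn_driftAmp {S : Set ℝ} (hS : S ⊆ Iio 1) : ContDiffOn ℝ ∞ driftAmp S := by
  have h1 : ContDiffOn ℝ ∞ (fun t : ℝ => 1 - t) S := (contDiff_const.sub contDiff_id).contDiffOn
  have h2 : MapsTo (fun t : ℝ => 1 - t) S ({0}ᶜ) := fun t ht => by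
    simp only [mem_compl_iff, mem_singleton_iff]
    exact (sub_pos.2 (show t < 1 from hS ht)).ne'
  exact (Real.contDiffOn_log.comp h1 h2).neg

/-- The drift flow is a classical solution on `[0, 1)`, for every viscosity. -/
theorem isClassical_drift (ν : ℝ) : IsClassicalNSSolutionOn (Ico 0 1) ν 0 driftVel driftPres :=
  isClassicalNSSolutionOn_uniform (uniqueDiffOn_Ico 0 1) (contDiffOn_driftAmp Ico_subset_Iio_self) ν e₀

theorem driftAmp_zero : driftAmp 0 = 0 := by simp [driftAmp]

/-- The drift flow starts from rest. -/
theorem driftVel_zero : driftVel 0 = 0 := by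
  funext x
  simp [driftVel, driftAmp_zero]

/-- The zero datum decays rapidly. -/
theorem hasRapidSpatialDecay_zero : HasRapidSpatialDecay (0 : ℝ³ → ℝ³) := fun n K =>
  ⟨0, fun x => by
    have : iteratedFDeriv ℝ n (0 : ℝ³ → ℝ³) x = 0 := by
      rw [Pi.zero_def, iteratedFDeriv_fun_zero]; rfl
    rw [this, norm_zero, mul_zero]⟩

/-- The drift flow obeys the Type-I rate at `T = 1` with constant `2`. -/
theorem isTypeIBlowup_drift : IsTypeIBlowup driftVel 1 := by
  refine ⟨2, ?_⟩
  filter_upwards [Ioo_mem_nhdsLT (show (0 : ℝ) < 1 by norm_num)] with t ht x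
  have hy : 0 < 1 - t := sub_pos.2 ht.2
  have hle : 1 - t ≤ 1 := by linarith [ht.1]
  have hlog : Real.log (1 - t) ≤ 0 := Real.log_nonpos hy.le hle
  have hn : ‖driftVel t x‖ = -Real.log (1 - t) := by
    simp [driftVel, driftAmp, norm_smul, abs_of_nonpos hlog]
  rw [hn]
  exact neg_log_le_two_div_sqrt hy

/-- The amplitude blows up as `t ↑ 1`. -/
theorem tendsto_driftAmp_atTop : Tendsto driftAmp (𝓝[<] 1) atTop := by
  have h1 : Tendsto (fun t : ℝ => 1 - t) (𝓝[<] 1) (𝓝[>] 0) := by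
    refine tendsto_nhdsWithin_iff.2 ⟨?_, ?_⟩
    · have h : Tendsto (fun t : ℝ => 1 - t) (𝓝 1) (𝓝 (1 - 1)) := tendsto_const_nhds.sub tendsto_id
      rw [sub_self] at h
      exact h.mono_left nhdsWithin_le_nhds
    · filter_upwards [self_mem_nhdsWithin] with t ht
      exact mem_Ioi.2 (sub_pos.2 (mem_Iio.1 ht))
  exact tendsto_neg_atBot_atTop.comp (Real.tendsto_log_nhdsGT_zero.comp h1)

/-- **The drift flow has no classical extension past `T = 1`**: an extension would be continuous
at `(1, 0)` from inside `[0, T') × ℝ³`, but `‖u(t, 0)‖ = -log(1 - t) → ∞` as `t ↑ 1`. -/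
theorem not_hasSmoothExtensionPast_drift (ν : ℝ) : ¬ HasSmoothExtensionPast ν 0 driftVel 1 := by
  rintro ⟨T', hT', u', p', hcl, hagree⟩
  have hmem : ((1 : ℝ), (0 : ℝ³)) ∈ Ico 0 T' ×ˢ (univ : Set ℝ³) :=
    mk_mem_prod ⟨zero_le_one, hT'⟩ (mem_univ _)
  have hcont : ContinuousWithinAt (uncurry u') (Ico 0 T' ×ˢ univ) (1, 0) :=
    hcl.smooth_velocity.continuousOn _ hmem
  have hγ : Tendsto (fun t : ℝ => ((t, (0 : ℝ³)) : ℝ × ℝ³)) (𝓝[<] 1)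
      (𝓝[Ico 0 T' ×ˢ univ] ((1 : ℝ), (0 : ℝ³))) := by
    refine tendsto_nhdsWithin_iff.2 ⟨?_, ?_⟩
    · exact ((continuous_id.prodMk continuous_const).tendsto 1).mono_left nhdsWithin_le_nhds
    · filter_upwards [Ioo_mem_nhdsLT (show (0 : ℝ) < 1 by norm_num)] with t ht
      exact mk_mem_prod ⟨ht.1.le, ht.2.trans hT'⟩ (mem_univ _)
  have hlim : Tendsto (fun t => u' t 0) (𝓝[<] 1) (𝓝 (u' 1 0)) := hcont.tendsto.comp hγ
  have heq : (fun t => driftAmp t • e₀) =ᶠ[𝓝[<] 1] fun t => u' t 0 := by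
    filter_upwards [Ioo_mem_nhdsLT (show (0 : ℝ) < 1 by norm_num)] with t ht
    rw [hagree t ⟨ht.1.le, ht.2⟩]
    rfl
  have hnorm : Tendsto (fun t => ‖driftAmp t • e₀‖) (𝓝[<] 1) (𝓝 ‖u' 1 0‖) :=
    (hlim.congr' heq.symm).norm
  have hnorm' : Tendsto (fun t => ‖driftAmp t • e₀‖) (𝓝[<] 1) atTop := by
    have h : Tendsto (fun t => |driftAmp t|) (𝓝[<] 1) atTop :=
      tendsto_abs_atTop_atTop.comp tendsto_driftAmp_atTop
    simpa [norm_smul] using h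
  exact not_tendsto_atTop_of_tendsto_nhds hnorm hnorm'

/-- The crux with the Leray–Hopf clause `IsLerayHopfOn T ν 0 (u 0) u` DELETED. -/
def TargetWithoutLerayHopf : Prop :=
  ∀ (ν T : ℝ), 0 < ν → 0 < T → ∀ (u : ℝ → ℝ³ → ℝ³) (p : ℝ → ℝ³ → ℝ),
    IsClassicalNSSolutionOn (Set.Ico 0 T) ν 0 u p → HasRapidSpatialDecay (u 0) →
    IsTypeIBlowup u T → HasSmoothExtensionPast ν 0 u T

/-- **Any proof of the crux must use the Leray–Hopf clause**: without it the statement is false,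
witnessed by the drift flow (`ν = 1`, `T = 1`). Classification if it were the crux:
refuted-misstated (missing finite-energy normalisation); the crux itself carries the clause. -/
theorem target_false_without_lerayHopf : ¬ TargetWithoutLerayHopf := fun h =>
  not_hasSmoothExtensionPast_drift 1
    (h 1 1 one_pos one_pos driftVel driftPres (isClassical_drift 1)
      (by rw [driftVel_zero]; exact hasRapidSpatialDecay_zero) isTypeIBlowup_drift)

/-- Sanity: with the Leray–Hopf clause restored the drift flow is no longer admissible — the
crux applied to it would yield the (refuted) extension, so `Target` implies the drift flow is not
Leray–Hopf from rest. -/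
theorem not_isLerayHopfOn_drift_of_target (h : Target) {ν : ℝ} (hν : 0 < ν) :
    ¬ IsLerayHopfOn 1 ν 0 (driftVel 0) driftVel := fun hLH =>
  not_hasSmoothExtensionPast_drift ν
    (h ν 1 hν one_pos driftVel driftPres (isClassical_drift ν) hLH
      (by rw [driftVel_zero]; exact hasRapidSpatialDecay_zero) isTypeIBlowup_drift)

/-! ### §2b Of the Leray–Hopf bundle only finite energy is load-bearing

The drift flow is even a WEAK solution (pressure-free formulation against divergence-free tests,
with datum): compactly supported divergence-free fields have zero mean
(`integral_inner_const_eq_zero_of_isDivFree`, KNSS 2009 §1 p. 3), so every spatial pairing of the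
uniform field with `∂ₜψ`, `(u·∇)ψ`, `Δψ`, `ψ(0)` vanishes. Hence replacing `IsLerayHopfOn` by its
first field `IsWeakNSSolutionOn` (deleting exactly the finite-energy clauses: `L^∞L²`, `L²` slices,
`L²Ḣ¹` + energy inequalities, `L²`-continuity) still gives a FALSE statement. -/

/-- A compactly supported continuous field pairs integrably with a constant. -/
theorem integrable_inner_const {g : ℝ³ → ℝ³} (hg : Continuous g) (hgc : HasCompactSupport g)
    (c : ℝ³) : Integrable (fun x => ⟪c, g x⟫) volume :=
  (continuous_const.inner hg).integrable_of_hasCompactSupport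
    (hgc.comp_left (g := fun v : ℝ³ => ⟪c, v⟫) (inner_zero_right c))

/-- **Uniform flows with a locally square-integrable measurable amplitude are weak solutions**
(pressure-free, with datum `a(0) e`) on `[0, T)`, for every viscosity. -/
theorem isWeakNSSolutionOn_uniform {T ν : ℝ} {a : ℝ → ℝ} (ham : Measurable a)
    (ha2 : ∫⁻ t in Ioo 0 T, ‖a t‖ₑ ^ 2 < ⊤) (e : ℝ³) (he : ‖e‖ = 1) :
    IsWeakNSSolutionOn T ν 0 (uniformVel a e 0) (uniformVel a e) := by
  refine ⟨?_, ?_, ?_, ?_⟩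
  · -- measurability
    exact ((ham.comp measurable_fst).smul_const e).aestronglyMeasurable
  · -- local square integrability up to the time boundary
    intro K hK
    have hGm : Measurable fun t => ‖a t‖ₑ ^ 2 := ham.enorm.pow_const 2
    have h1 : ∫⁻ z in Ioo 0 T ×ˢ K, ‖uncurry (uniformVel a e) z‖ₑ ^ 2 =
        ∫⁻ z in Ioo 0 T ×ˢ K, ‖a z.1‖ₑ ^ 2 := by
      refine lintegral_congr fun z => ?_
      show ‖a z.1 • e‖ₑ ^ 2 = ‖a z.1‖ₑ ^ 2
      rw [enorm_smul, ← ofReal_norm e, he, ENNReal.ofReal_one, mul_one]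
    have h2 : ∫⁻ z in Ioo 0 T ×ˢ K, ‖a z.1‖ₑ ^ 2 = (∫⁻ t in Ioo 0 T, ‖a t‖ₑ ^ 2) * volume K := by
      rw [Measure.volume_eq_prod, ← Measure.prod_restrict,
        lintegral_prod (fun z : ℝ × ℝ³ => ‖a z.1‖ₑ ^ 2) (hGm.comp measurable_fst).aemeasurable]
      simp only [lintegral_const, Measure.restrict_apply_univ]
      rw [lintegral_mul_const _ hGm]
    rw [h1, h2]
    exact ENNReal.mul_lt_top ha2 hK.measure_lt_top
  · -- weakly divergence free slices
    exact ae_of_all _ fun t =>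
      VectorCalculus.IsDivFree.isWeaklyDivFree_holds (isDivFree_const (a t • e)) contDiff_const
  · -- the weak identity: every spatial pairing vanishes
    intro ψ hψ hdiv
    have hψ' : IsSpaceTimeTestOn (⊤ : Opens (ℝ × ℝ³)) ψ := hψ.mono le_top
    have hslice : ∀ t, ∫ x, (⟪uniformVel a e t x, timeDeriv ψ t x⟫ +
        ⟪uniformVel a e t x, convect (uniformVel a e t) (ψ t) x⟫ +
        ν * ⟪uniformVel a e t x, Δ (ψ t) x⟫ + ⟪(0 : ℝ → ℝ³ → ℝ³) t x, ψ t x⟫) = 0 := by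
      intro t
      set c : ℝ³ := a t • e with hc
      -- the three compactly supported divergence-free `C¹` fields
      have hψ3 : ContDiff ℝ 3 (ψ t) := contDiff_infty.1 (hψ'.contDiff_slice t) 3
      have hψ2 : ContDiff ℝ 2 (ψ t) := contDiff_infty.1 (hψ'.contDiff_slice t) 2
      have g1d : ContDiff ℝ 1 (timeDeriv ψ t) := contDiff_infty.1 (hψ'.timeDeriv_top.contDiff_slice t) 1
      have g1c : HasCompactSupport (timeDeriv ψ t) := hψ'.timeDeriv_top.hasCompactSupport_slice t
      have g1v : VectorCalculus.IsDivFree (timeDeriv ψ t) := hψ'.isDivFree_timeDeriv hdiv t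
      have g2d : ContDiff ℝ 1 (fun x => fderiv ℝ (ψ t) x c) :=
        (hψ2.fderiv_right (m := 1) (by norm_num)).clm_apply contDiff_const
      have g2c : HasCompactSupport (fun x => fderiv ℝ (ψ t) x c) :=
        (hψ'.hasCompactSupport_slice t).fderiv_apply (𝕜 := ℝ) c
      have g2v : VectorCalculus.IsDivFree (fun x => fderiv ℝ (ψ t) x c) :=
        VectorCalculus.IsDivFree.fderiv_apply hψ2 (hdiv t) c
      have g3d : ContDiff ℝ 1 (Δ (ψ t)) := contDiff_infty.1 (hψ'.laplacian_top.contDiff_slice t) 1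
      have g3c : HasCompactSupport (Δ (ψ t)) := hψ'.laplacian_top.hasCompactSupport_slice t
      have g3v : VectorCalculus.IsDivFree (Δ (ψ t)) := isDivFree_laplacian_of_contDiff hψ3 (hdiv t)
      have i1 := integral_inner_const_eq_zero_of_isDivFree c g1d g1c g1v
      have i2 := integral_inner_const_eq_zero_of_isDivFree c g2d g2c g2v
      have i3 := integral_inner_const_eq_zero_of_isDivFree c g3d g3c g3v
      have I1 := integrable_inner_const g1d.continuous g1c c
      have I2 := integrable_inner_const g2d.continuous g2c c
      have I3 := (integrable_inner_const g3d.continuous g3c c).const_mul ν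
      have hfun : (fun x => ⟪uniformVel a e t x, timeDeriv ψ t x⟫ +
          ⟪uniformVel a e t x, convect (uniformVel a e t) (ψ t) x⟫ +
          ν * ⟪uniformVel a e t x, Δ (ψ t) x⟫ + ⟪(0 : ℝ → ℝ³ → ℝ³) t x, ψ t x⟫) =
          fun x => ⟪c, timeDeriv ψ t x⟫ + ⟪c, fderiv ℝ (ψ t) x c⟫ + ν * ⟪c, Δ (ψ t) x⟫ := by
        funext x
        simp [hc, convect]
      have I12 : Integrable (fun x => ⟪c, timeDeriv ψ t x⟫ + ⟪c, fderiv ℝ (ψ t) x c⟫) volume :=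
        I1.add I2
      rw [hfun, integral_add I12 I3, integral_add I1 I2, integral_const_mul, i1, i2, i3]
      ring
    have hdatum : ∫ x, ⟪uniformVel a e 0 x, ψ 0 x⟫ = 0 :=
      integral_inner_const_eq_zero_of_isDivFree (a 0 • e)
        (contDiff_infty.1 (hψ'.contDiff_slice 0) 1) (hψ'.hasCompactSupport_slice 0) (hdiv 0)
    simp_rw [hslice]
    rw [hdatum, integral_zero, add_zero]

theorem measurable_driftAmp : Measurable driftAmp :=
  (Real.measurable_log.comp (measurable_const.sub measurable_id)).neg

/-- `(-log y)² ≤ 16 y^{-1/2}` on `0 < y ≤ 1`. -/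
theorem neg_log_sq_le {y : ℝ} (hy : 0 < y) (hy1 : y ≤ 1) :
    (-Real.log y) ^ 2 ≤ 16 * y ^ (-(1 / 2 : ℝ)) := by
  have h := neg_log_le_rpow_div hy (by norm_num : (0 : ℝ) < 1 / 4)
  have h0 : 0 ≤ -Real.log y := by
    have := Real.log_nonpos hy.le hy1
    linarith
  have h4 : -Real.log y ≤ 4 * y ^ (-(1 / 4 : ℝ)) := by
    calc -Real.log y ≤ y ^ (-(1 / 4 : ℝ)) / (1 / 4) := h
      _ = 4 * y ^ (-(1 / 4 : ℝ)) := by ring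
  have hpow : (y ^ (-(1 / 4 : ℝ))) ^ 2 = y ^ (-(1 / 2 : ℝ)) := by
    rw [← Real.rpow_natCast, ← Real.rpow_mul hy.le]
    norm_num
  calc (-Real.log y) ^ 2 ≤ (4 * y ^ (-(1 / 4 : ℝ))) ^ 2 := by gcongr
    _ = 16 * y ^ (-(1 / 2 : ℝ)) := by rw [mul_pow, hpow]; norm_num

/-- The drift amplitude is square integrable in time on `(0, 1)`. -/
theorem lintegral_driftAmp_sq_lt_top : ∫⁻ t in Ioo (0 : ℝ) 1, ‖driftAmp t‖ₑ ^ 2 < ⊤ := by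
  have hint : IntervalIntegrable (fun x : ℝ => x ^ (-(1 / 2 : ℝ))) volume 0 1 :=
    intervalIntegral.intervalIntegrable_rpow' (by norm_num)
  have hint2 : IntervalIntegrable (fun x : ℝ => (1 - x) ^ (-(1 / 2 : ℝ))) volume (1 - 0) (1 - 1) :=
    hint.comp_sub_left 1
  rw [sub_zero, sub_self] at hint2
  have hint3 : IntegrableOn (fun x : ℝ => 16 * (1 - x) ^ (-(1 / 2 : ℝ))) (Ioo 0 1) :=
    ((intervalIntegrable_iff_integrableOn_Ioo_of_le (by norm_num)).1 hint2.symm).const_mul 16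
  refine lt_of_le_of_lt (setLIntegral_mono' measurableSet_Ioo fun t ht => ?_) hint3.setLIntegral_lt_top
  have hy : 0 < 1 - t := sub_pos.2 ht.2
  have hy1 : 1 - t ≤ 1 := by linarith [ht.1]
  rw [← ofReal_norm, ← ENNReal.ofReal_pow (norm_nonneg _), Real.norm_eq_abs, driftAmp,
    abs_of_nonneg (by have := Real.log_nonpos hy.le hy1; linarith)]
  exact ENNReal.ofReal_le_ofReal (neg_log_sq_le hy hy1)

/-- The drift flow is a weak solution on `[0, 1)` from rest, for every viscosity. -/
theorem isWeakNSSolutionOn_drift (ν : ℝ) : IsWeakNSSolutionOn 1 ν 0 (driftVel 0) driftVel :=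
  isWeakNSSolutionOn_uniform measurable_driftAmp lintegral_driftAmp_sq_lt_top e₀ norm_e₀

/-- The crux with `IsLerayHopfOn T ν 0 (u 0) u` WEAKENED to its first field, the pressure-free
weak formulation `IsWeakNSSolutionOn T ν 0 (u 0) u` (all finite-energy clauses deleted). -/
def TargetWithoutEnergy : Prop :=
  ∀ (ν T : ℝ), 0 < ν → 0 < T → ∀ (u : ℝ → ℝ³ → ℝ³) (p : ℝ → ℝ³ → ℝ),
    IsClassicalNSSolutionOn (Set.Ico 0 T) ν 0 u p → IsWeakNSSolutionOn T ν 0 (u 0) u →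
    HasRapidSpatialDecay (u 0) → IsTypeIBlowup u T → HasSmoothExtensionPast ν 0 u T

/-- **Of the Leray–Hopf bundle, only the finite-energy clauses are load-bearing**: keeping the weak
formulation but deleting the energy class, the statement is false (drift flow again). So any
proof of the crux must use `u(t) ∈ L²` / the energy inequality — not merely that `u` is a weak
solution. -/
theorem target_false_without_energy : ¬ TargetWithoutEnergy := fun h =>
  not_hasSmoothExtensionPast_drift 1
    (h 1 1 one_pos one_pos driftVel driftPres (isClassical_drift 1) (isWeakNSSolutionOn_drift 1)
      (by rw [driftVel_zero]; exact hasRapidSpatialDecay_zero) isTypeIBlowup_drift)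

end Drift

/-! ## §3 The local reduction: pressure integrability is load-bearing -/

section Local

/-- The provers' local hypothesis `hloc` of
`Theorems.noTypeIBlowup_of_local_typeI_regularity` (Seregin–Šverák 2009, Thm 3.1 with the
axial symmetry deleted; OPEN), verbatim. -/
def LocalTypeIRegularity : Prop :=
  ∀ (v : ℝ → ℝ³ → ℝ³) (π : ℝ → ℝ³ → ℝ),
    IsDistributionalNSSolutionOn ssCylinderOpens 1 0 v π →
    (∫⁻ z in ssCylinder, ‖v z.1 z.2‖ₑ ^ (3 : ℕ) < ⊤) →
    (∫⁻ z in ssCylinder, ‖π z.1 z.2‖ₑ ^ (3 / 2 : ℝ) < ⊤) →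
    (∃ C : ℝ, ∀ᵐ z ∂(volume.restrict ssCylinder), Real.sqrt (-z.1) * ‖v z.1 z.2‖ ≤ C) →
    ∃ r > 0, eLpNorm (uncurry v) ⊤
      (volume.restrict (parabolicCylinder r ((0 : ℝ), (0 : ℝ³)))) < ⊤

/-- The provers' reduction, re-exported: the local statement implies the crux (tree theorem
`Theorems.noTypeIBlowup_of_local_typeI_regularity`, sorry-free). -/
theorem target_of_localTypeIRegularity (h : LocalTypeIRegularity) : Target :=
  Theorems.noTypeIBlowup_of_local_typeI_regularity h

/-- `LocalTypeIRegularity` with the pressure clause `π ∈ L^{3/2}(Q)` DELETED. -/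
def LocalTypeIRegularityWithoutPressure : Prop :=
  ∀ (v : ℝ → ℝ³ → ℝ³) (π : ℝ → ℝ³ → ℝ),
    IsDistributionalNSSolutionOn ssCylinderOpens 1 0 v π →
    (∫⁻ z in ssCylinder, ‖v z.1 z.2‖ₑ ^ (3 : ℕ) < ⊤) →
    (∃ C : ℝ, ∀ᵐ z ∂(volume.restrict ssCylinder), Real.sqrt (-z.1) * ‖v z.1 z.2‖ ≤ C) →
    ∃ r > 0, eLpNorm (uncurry v) ⊤
      (volume.restrict (parabolicCylinder r ((0 : ℝ), (0 : ℝ³)))) < ⊤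

/-- The local drift amplitude `a(s) = -log(-s)` (the drift flow in the time variable `s = t - 1`). -/
def localAmp (s : ℝ) : ℝ := -Real.log (-s)

/-- The local drift flow `v(s, y) = -log(-s) e₀`. -/
def localVel : ℝ → ℝ³ → ℝ³ := uniformVel localAmp e₀

/-- Its pressure `π(s, y) = ⟪-a'(s) e₀, y⟫ = -y₀ / (-s)` on `s < 0` — NOT in `L^{3/2}(Q)`
(`∫_{-1}^0 (-s)^{-3/2} ds = ∞`), consistently with `LocalTypeIRegularity`. -/
def localPres : ℝ → ℝ³ → ℝ := uniformPres (derivWithin localAmp (Ioo (-1) 0)) e₀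

theorem contDiffOn_localAmp : ContDiffOn ℝ ∞ localAmp (Ioo (-1) 0) := by
  have h1 : ContDiffOn ℝ ∞ (fun s : ℝ => -s) (Ioo (-1) 0) := contDiff_neg.contDiffOn
  have h2 : MapsTo (fun s : ℝ => -s) (Ioo (-1 : ℝ) 0) ({0}ᶜ) := fun s hs => by
    simp only [mem_compl_iff, mem_singleton_iff, neg_eq_zero]
    exact hs.2.ne
  exact (Real.contDiffOn_log.comp h1 h2).neg

/-- The local drift flow is classical on the open time interval `(-1, 0)` (viscosity `1`). -/
theorem isClassical_local : IsClassicalNSSolutionOn (Ioo (-1) 0) 1 0 localVel localPres :=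
  isClassicalNSSolutionOn_uniform (uniqueDiffOn_Ioo (-1) 0) contDiffOn_localAmp 1 e₀

/-- … hence a distributional solution in the Seregin–Šverák cylinder `Q = 𝒞 × ]-1, 0[`. -/
theorem isDistributional_local : IsDistributionalNSSolutionOn ssCylinderOpens 1 0 localVel localPres := by
  have hcl := isClassical_local
  have hQ : ((ssCylinderOpens : Opens (ℝ × ℝ³)) : Set (ℝ × ℝ³)) ⊆ Ioo (-1) 0 ×ˢ univ := by
    intro z hz
    exact mk_mem_prod (mem_ssCylinder.1 hz).1 (mem_univ _)
  refine isDistributionalNSSolutionOn_of_contDiffOn isOpen_Ioo hQ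
    (hcl.smooth_velocity.of_le (by norm_cast)) (hcl.smooth_pressure.of_le (by norm_cast))
    continuousOn_const (fun t ht x => ?_) hcl.divFree
  have hm := hcl.momentum t ht x
  rwa [timeDerivWithin_eq_deriv isOpen_Ioo ht, ← timeDeriv_apply] at hm

/-- Pointwise size of the local drift flow: `‖v(s, y)‖ = -log(-s)` for `-1 < s < 0`. -/
theorem norm_localVel {s : ℝ} (hs : s ∈ Ioo (-1 : ℝ) 0) (y : ℝ³) :
    ‖localVel s y‖ = -Real.log (-s) := by
  have hy : 0 < -s := neg_pos.2 hs.2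
  have hle : -s ≤ 1 := by linarith [hs.1]
  have hlog : Real.log s ≤ 0 := by
    rw [← Real.log_neg_eq_log]
    exact Real.log_nonpos hy.le hle
  simp [localVel, localAmp, norm_smul, abs_of_nonpos hlog, Real.log_neg_eq_log]

/-- The local drift flow has the a.e. Type-I rate on `Q` with constant `2`. -/
theorem localVel_typeI :
    ∃ C : ℝ, ∀ᵐ z ∂(volume.restrict ssCylinder), Real.sqrt (-z.1) * ‖localVel z.1 z.2‖ ≤ C := by
  refine ⟨2, (ae_restrict_iff' isOpen_ssCylinder.measurableSet).2 (ae_of_all _ fun z hz => ?_)⟩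
  have hs := (mem_ssCylinder.1 hz).1
  rw [norm_localVel hs]
  exact sqrt_mul_neg_log_le_two (neg_pos.2 hs.2)

/-- `(-log y)³ ≤ 64 y^{-3/4}` on `0 < y ≤ 1` (cube of `-log y ≤ 4 y^{-1/4}`). -/
theorem neg_log_pow_three_le {y : ℝ} (hy : 0 < y) (hy1 : y ≤ 1) :
    (-Real.log y) ^ 3 ≤ 64 * y ^ (-(3 / 4 : ℝ)) := by
  have h := neg_log_le_rpow_div hy (by norm_num : (0 : ℝ) < 1 / 4)
  have h0 : 0 ≤ -Real.log y := by
    have := Real.log_nonpos hy.le hy1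
    linarith
  have h4 : -Real.log y ≤ 4 * y ^ (-(1 / 4 : ℝ)) := by
    calc -Real.log y ≤ y ^ (-(1 / 4 : ℝ)) / (1 / 4) := h
      _ = 4 * y ^ (-(1 / 4 : ℝ)) := by ring
  have hpow : (y ^ (-(1 / 4 : ℝ))) ^ 3 = y ^ (-(3 / 4 : ℝ)) := by
    rw [← Real.rpow_natCast, ← Real.rpow_mul hy.le]
    norm_num
  calc (-Real.log y) ^ 3 ≤ (4 * y ^ (-(1 / 4 : ℝ))) ^ 3 := by gcongr
    _ = 64 * y ^ (-(3 / 4 : ℝ)) := by rw [mul_pow, hpow]; norm_num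

/-- The majorant `s ↦ 64 (0 - s)^{-3/4}` is integrable on `(-1, 0)`. -/
theorem integrableOn_majorant :
    IntegrableOn (fun s : ℝ => 64 * (0 - s) ^ (-(3 / 4 : ℝ))) (Ioo (-1) 0) := by
  have hint : IntervalIntegrable (fun x : ℝ => x ^ (-(3 / 4 : ℝ))) volume 0 1 :=
    intervalIntegral.intervalIntegrable_rpow' (by norm_num)
  have hint2 : IntervalIntegrable (fun x : ℝ => (0 - x) ^ (-(3 / 4 : ℝ))) volume (0 - 0) (0 - 1) :=
    hint.comp_sub_left 0
  rw [sub_zero, zero_sub] at hint2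
  have hint3 : IntegrableOn (fun x : ℝ => (0 - x) ^ (-(3 / 4 : ℝ))) (Ioo (-1) 0) :=
    (intervalIntegrable_iff_integrableOn_Ioo_of_le (by norm_num)).1 hint2.symm
  exact hint3.const_mul 64

/-- The local drift flow lies in `L³(Q)`. -/
theorem lintegral_localVel_cube_lt_top :
    ∫⁻ z in ssCylinder, ‖localVel z.1 z.2‖ₑ ^ (3 : ℕ) < ⊤ := by
  set G : ℝ → ENNReal := fun s => ENNReal.ofReal (64 * (0 - s) ^ (-(3 / 4 : ℝ))) with hG
  have hGm : Measurable G := by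
    refine ENNReal.measurable_ofReal.comp ?_
    exact measurable_const.mul ((measurable_const.sub measurable_id).pow_const _)
  -- pointwise majorant on `Q`
  have hbound : ∀ z ∈ ssCylinder, ‖localVel z.1 z.2‖ₑ ^ (3 : ℕ) ≤ G z.1 := by
    intro z hz
    have hs := (mem_ssCylinder.1 hz).1
    have hy : 0 < -z.1 := neg_pos.2 hs.2
    have hy1 : -z.1 ≤ 1 := by linarith [hs.1]
    rw [← ofReal_norm, ← ENNReal.ofReal_pow (norm_nonneg _), norm_localVel hs, hG]
    simp only [zero_sub]
    exact ENNReal.ofReal_le_ofReal (neg_log_pow_three_le hy hy1)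
  -- `Q ⊆ (-1, 0) × B(0, 2)`
  have hsub : ssCylinder ⊆ Ioo (-1 : ℝ) 0 ×ˢ ball (0 : ℝ³) 2 := fun z hz =>
    mk_mem_prod (mem_ssCylinder.1 hz).1 (mem_ball_zero_iff.2 (norm_lt_two_of_mem_ssCylinder hz))
  have h1 : ∫⁻ z in ssCylinder, ‖localVel z.1 z.2‖ₑ ^ (3 : ℕ) ≤ ∫⁻ z in ssCylinder, G z.1 :=
    setLIntegral_mono' isOpen_ssCylinder.measurableSet fun z hz => hbound z hz
  have h2 : ∫⁻ z in ssCylinder, G z.1 ≤ ∫⁻ z in Ioo (-1 : ℝ) 0 ×ˢ ball (0 : ℝ³) 2, G z.1 :=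
    lintegral_mono_set hsub
  have h3 : ∫⁻ z in Ioo (-1 : ℝ) 0 ×ˢ ball (0 : ℝ³) 2, G z.1 =
      (∫⁻ s in Ioo (-1 : ℝ) 0, G s) * volume (ball (0 : ℝ³) 2) := by
    rw [Measure.volume_eq_prod, ← Measure.prod_restrict,
      lintegral_prod (fun z : ℝ × ℝ³ => G z.1) (hGm.comp measurable_fst).aemeasurable]
    simp only [lintegral_const, Measure.restrict_apply_univ]
    rw [lintegral_mul_const _ hGm]
  have h4 : ∫⁻ s in Ioo (-1 : ℝ) 0, G s < ⊤ := integrableOn_majorant.setLIntegral_lt_top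
  have h5 : volume (ball (0 : ℝ³) 2) < ⊤ := measure_ball_lt_top
  calc ∫⁻ z in ssCylinder, ‖localVel z.1 z.2‖ₑ ^ (3 : ℕ)
      ≤ (∫⁻ s in Ioo (-1 : ℝ) 0, G s) * volume (ball (0 : ℝ³) 2) := (h1.trans h2).trans h3.le
    _ < ⊤ := ENNReal.mul_lt_top h4 h5

/-- **The local drift flow is essentially unbounded on every backward cylinder about the vertex.** -/
theorem localVel_not_bounded_near_vertex :
    ¬ ∃ r > 0, eLpNorm (uncurry localVel) ⊤
      (volume.restrict (parabolicCylinder r ((0 : ℝ), (0 : ℝ³)))) < ⊤ := by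
  rintro ⟨r, hr, hfin⟩
  set μr := (volume : Measure (ℝ × ℝ³)).restrict (parabolicCylinder r ((0 : ℝ), (0 : ℝ³))) with hμr
  rw [eLpNorm_exponent_top] at hfin
  set S := eLpNormEssSup (uncurry localVel) μr with hSdef
  have hae : ∀ᵐ z ∂μr, ‖uncurry localVel z‖ₑ ≤ S := enorm_ae_le_eLpNormEssSup _ _
  set M : ℝ := S.toReal with hM
  have hSM : S = ENNReal.ofReal M := (ENNReal.ofReal_toReal hfin.ne).symm
  have hM0 : 0 ≤ M := ENNReal.toReal_nonneg
  -- the bad set `U = (-ε, 0) × B(0, r)` on which `‖v‖ > M + 1`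
  set ε : ℝ := min (r ^ 2) (Real.exp (-(M + 1))) with hε
  have hεpos : 0 < ε := lt_min (by positivity) (Real.exp_pos _)
  set U : Set (ℝ × ℝ³) := Ioo (-ε) 0 ×ˢ ball (0 : ℝ³) r with hU
  have hUsub : U ⊆ parabolicCylinder r ((0 : ℝ), (0 : ℝ³)) := by
    rintro ⟨s, y⟩ ⟨hs, hy⟩
    refine mk_mem_prod ⟨?_, hs.2⟩ hy
    have : ε ≤ r ^ 2 := min_le_left _ _
    show (0 : ℝ) - r ^ 2 < s
    linarith [hs.1]
  have hUmeas : MeasurableSet U := measurableSet_Ioo.prod measurableSet_ball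
  have hbig : ∀ z ∈ U, S < ‖uncurry localVel z‖ₑ := by
    rintro ⟨s, y⟩ ⟨hs, -⟩
    have hspos : 0 < -s := neg_pos.2 hs.2
    have hεe : ε ≤ Real.exp (-(M + 1)) := min_le_right _ _
    have hε1 : ε ≤ 1 := hεe.trans (Real.exp_le_one_iff.2 (by linarith))
    have hs' : s ∈ Ioo (-1 : ℝ) 0 := ⟨by linarith [hs.1], hs.2⟩
    have hlt : -s < Real.exp (-(M + 1)) := by linarith [hs.1]
    have hlog : Real.log (-s) < -(M + 1) := by
      have := Real.log_lt_log hspos hlt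
      rwa [Real.log_exp] at this
    have hval : ‖uncurry localVel (s, y)‖ = -Real.log (-s) := norm_localVel hs' y
    rw [hSM, ← ofReal_norm, hval]
    exact (ENNReal.ofReal_lt_ofReal_iff (by linarith)).2 (by linarith)
  have h1 : ∀ᵐ z ∂(volume.restrict U), ‖uncurry localVel z‖ₑ ≤ S :=
    ae_restrict_of_ae_restrict_of_subset hUsub hae
  have h2 : ∀ᵐ z ∂(volume.restrict U), S < ‖uncurry localVel z‖ₑ :=
    (ae_restrict_iff' hUmeas).2 (ae_of_all _ hbig)
  have h3 : ∀ᵐ z ∂(volume.restrict U), False := by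
    filter_upwards [h1, h2] with z h1 h2 using absurd h1 (not_le.2 h2)
  have hzero : (volume : Measure (ℝ × ℝ³)).restrict U = 0 := by
    rwa [Filter.eventually_false_iff_eq_bot, ae_eq_bot] at h3
  have hUpos : 0 < (volume : Measure (ℝ × ℝ³)) U := by
    rw [hU, Measure.volume_eq_prod, Measure.prod_prod]
    refine ENNReal.mul_pos ?_ (measure_ball_pos volume (0 : ℝ³) hr).ne'
    rw [Real.volume_Ioo]
    simp [hεpos]
  rw [Measure.restrict_eq_zero] at hzero
  exact hUpos.ne' hzero

/-- **Any proof of the local statement must use the pressure integrability `π ∈ L^{3/2}(Q)`**: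
with that clause deleted the statement is false (local drift flow). Equivalently: the local Type-I
class `L³(Q)` + a.e. rate + distributional does NOT control the local energy, and Serrin-type
parasitic solutions live in it. -/
theorem localTypeIRegularity_false_without_pressure : ¬ LocalTypeIRegularityWithoutPressure :=
  fun h => localVel_not_bounded_near_vertex
    (h localVel localPres isDistributional_local lintegral_localVel_cube_lt_top localVel_typeI)

end Local

/-! ## §4 Profile of a counterexample (consequences of proved tree theorems) -/

section Profile

variable {ν T : ℝ} {u : ℝ → ℝ³ → ℝ³} {p : ℝ → ℝ³ → ℝ}

/-- A counterexample is a maximal smooth solution with lifespan `T`. -/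
theorem counterexample_isMaximal (hcl : IsClassicalNSSolutionOn (Ico 0 T) ν 0 u p)
    (hext : ¬ HasSmoothExtensionPast ν 0 u T) : IsMaximalSmoothSolution ν 0 u p T :=
  ⟨hcl, hext⟩

/-- **A counterexample is genuinely unbounded on `[0, T) × ℝ³`** (contrapositive of the proved
continuation theorem `hasSmoothExtensionPast_of_bounded_holds`, RRS 2016 Thm 8.17). Neither the
decay of the datum nor the Type-I rate is needed for this. -/
theorem counterexample_unbounded (hν : 0 < ν) (hT : 0 < T)
    (hcl : IsClassicalNSSolutionOn (Ico 0 T) ν 0 u p) (hLH : IsLerayHopfOn T ν 0 (u 0) u)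
    (hext : ¬ HasSmoothExtensionPast ν 0 u T) :
    ∀ M : ℝ, ∃ t ∈ Ico 0 T, ∃ x, M < ‖u t x‖ := by
  intro M
  by_contra h
  have hb : ∀ t ∈ Ico 0 T, ∀ x, ‖u t x‖ ≤ M := fun t ht x =>
    not_lt.1 fun hlt => h ⟨t, ht, x, hlt⟩
  exact hext (hasSmoothExtensionPast_of_bounded_holds hν hT hcl hLH ⟨M, hb⟩)

/-- **… but it is essentially bounded on every earlier slab `[0, T'] × ℝ³`, `T' < T`** (proved
tree theorem `eLpNorm_uncurry_top_lt_top_of_tao2011` with the discharged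
`tao2011_hasBoundedSobolevNormsOn_holds`: finite-energy classical solutions from Schwartz data
have bounded Sobolev norms on closed slabs). So the blow-up of a counterexample happens exactly
at `T`, not before and not at spatial infinity at an earlier time. -/
theorem counterexample_bounded_before (hν : 0 < ν)
    (hcl : IsClassicalNSSolutionOn (Ico 0 T) ν 0 u p) (hLH : IsLerayHopfOn T ν 0 (u 0) u)
    (hdec : HasRapidSpatialDecay (u 0)) :
    ∀ T' ∈ Ioo 0 T, eLpNorm (uncurry u) ⊤ (volume.restrict (Icc 0 T' ×ˢ univ)) < ⊤ :=
  eLpNorm_uncurry_top_lt_top_of_tao2011 tao2011_hasBoundedSobolevNormsOn_holds hν hcl hLH hdec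

/-- **Leray's lower rate for a counterexample**: with Leray's universal constant `c > 0`
(`leray_blowup_rate_top_holds`, Leray 1934 §19 (3.9)), every counterexample satisfies
`‖u(t)‖_{L^∞} ≥ c √ν / √(T - t)` for EVERY `t ∈ [0, T)`. -/
theorem counterexample_leray_lower_bound :
    ∃ c : ℝ, 0 < c ∧ ∀ ⦃ν T : ℝ⦄ ⦃u : ℝ → ℝ³ → ℝ³⦄ ⦃p : ℝ → ℝ³ → ℝ⦄, 0 < ν → 0 < T →
      IsClassicalNSSolutionOn (Ico 0 T) ν 0 u p → IsLerayHopfOn T ν 0 (u 0) u →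
      HasRapidSpatialDecay (u 0) → ¬ HasSmoothExtensionPast ν 0 u T →
      ∀ t ∈ Ico 0 T, ENNReal.ofReal (c * Real.sqrt ν / Real.sqrt (T - t)) ≤ eLpNorm (u t) ⊤ volume := by
  obtain ⟨c, hc, h⟩ := leray_blowup_rate_top_holds
  exact ⟨c, hc, fun ν T u p hν hT hcl hLH hdec hext =>
    h ν T hν hT u p ⟨hcl, hext⟩ hLH (counterexample_bounded_before hν hcl hLH hdec)⟩

/-- **The Type-I constant of a counterexample is at least Leray's**: `c √ν ≤ C` for every `C`
admissible in `IsTypeIBlowup u T` (in the normal form `ν = 1`: the one dimensionless parameter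
of the counterexample search satisfies `C ≥ c_Leray`; the route's `RungZero`, stmt-…-2886, is the
positive reading). Hand calibration of the triage panel (module docstring, (a)): in fact
`C ≥ √ν`, even `≥ 1.035 √ν` — not Lean-checked here. -/
theorem counterexample_typeI_constant_ge :
    ∃ c : ℝ, 0 < c ∧ ∀ ⦃ν T : ℝ⦄ ⦃u : ℝ → ℝ³ → ℝ³⦄ ⦃p : ℝ → ℝ³ → ℝ⦄, 0 < ν → 0 < T →
      IsClassicalNSSolutionOn (Ico 0 T) ν 0 u p → IsLerayHopfOn T ν 0 (u 0) u →
      HasRapidSpatialDecay (u 0) → ¬ HasSmoothExtensionPast ν 0 u T →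
      ∀ C : ℝ, (∀ᶠ t in 𝓝[<] T, ∀ x, ‖u t x‖ ≤ C / Real.sqrt (T - t)) → c * Real.sqrt ν ≤ C := by
  obtain ⟨c, hc, h⟩ := counterexample_leray_lower_bound
  refine ⟨c, hc, fun ν T u p hν hT hcl hLH hdec hext C hC => ?_⟩
  obtain ⟨T₁, hT₁T, hT₁⟩ := mem_nhdsLT_iff_exists_Ioo_subset.1 hC
  have hT₁T' : T₁ < T := hT₁T
  -- a time in `[0, T) ∩ (T₁, T)`
  set t : ℝ := max ((T₁ + T) / 2) 0 with ht
  have htT : t < T := max_lt (by linarith) hT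
  have htT₁ : T₁ < t := lt_of_lt_of_le (by linarith) (le_max_left _ _)
  have ht0 : 0 ≤ t := le_max_right _ _
  have hlow := h hν hT hcl hLH hdec hext t ⟨ht0, htT⟩
  have hup : eLpNorm (u t) ⊤ volume ≤ ENNReal.ofReal (C / Real.sqrt (T - t)) := by
    rw [eLpNorm_exponent_top]
    exact eLpNormEssSup_le_of_ae_bound (ae_of_all _ (hT₁ ⟨htT₁, htT⟩))
  have hsq : 0 < Real.sqrt (T - t) := Real.sqrt_pos.2 (sub_pos.2 htT)
  have hpos : 0 < c * Real.sqrt ν / Real.sqrt (T - t) := by positivity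
  have hle := (ENNReal.ofReal_le_ofReal_iff' ).1 (hlow.trans hup)
  rcases hle with hle | hle
  · rwa [div_le_div_iff_of_pos_right hsq] at hle
  · exact absurd hle (not_le.2 hpos)

/-- Measure-theoretic pattern used twice: an a.e. bound `g ≤ S` on `A` is incompatible with
`S < g` on a positive-measure measurable subset `U ⊆ A`. -/
theorem false_of_ae_le_of_lt_on {α : Type*} [MeasurableSpace α] {μ : Measure α} {g : α → ENNReal}
    {S : ENNReal} {A U : Set α} (hae : ∀ᵐ z ∂(μ.restrict A), g z ≤ S) (hUA : U ⊆ A)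
    (hU : MeasurableSet U) (hpos : μ U ≠ 0) (hbig : ∀ z ∈ U, S < g z) : False := by
  have h1 : ∀ᵐ z ∂(μ.restrict U), g z ≤ S := ae_restrict_of_ae_restrict_of_subset hUA hae
  have h2 : ∀ᵐ z ∂(μ.restrict U), S < g z := (ae_restrict_iff' hU).2 (ae_of_all _ hbig)
  have h3 : ∀ᵐ z ∂(μ.restrict U), False := by
    filter_upwards [h1, h2] with z h1 h2 using absurd h1 (not_le.2 h2)
  have hzero : μ.restrict U = 0 := by
    rwa [Filter.eventually_false_iff_eq_bot, ae_eq_bot] at h3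
  exact hpos (Measure.restrict_eq_zero.1 hzero)

/-- **A counterexample IS the Kato (mild, `C_t L³`) solution from its datum** — the weak–strong
identification behind "why it resists": the crux is a statement about THE mild solution from a
Schwartz datum (tree theorem `isKatoSolutionOn_of_classical`). -/
theorem counterexample_isKato (hν : 0 < ν) (hT : 0 < T)
    (hcl : IsClassicalNSSolutionOn (Ico 0 T) ν 0 u p) (hLH : IsLerayHopfOn T ν 0 (u 0) u)
    (hdec : HasRapidSpatialDecay (u 0)) : IsKatoSolutionOn T ν (u 0) u :=
  isKatoSolutionOn_of_classical hν hT hcl hLH hdec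

/-- … and `T` is the maximal time of the Kato solution: no Kato solution from `u 0` lives on a
longer interval (tree theorem `not_isKatoSolutionOn_of_not_hasSmoothExtensionPast`). So a
counterexample is a genuine finite-time blow-up of the mild solution from a Schwartz datum. -/
theorem counterexample_kato_maximal (hν : 0 < ν) (hT : 0 < T)
    (hcl : IsClassicalNSSolutionOn (Ico 0 T) ν 0 u p) (hLH : IsLerayHopfOn T ν 0 (u 0) u)
    (hdec : HasRapidSpatialDecay (u 0)) (hext : ¬ HasSmoothExtensionPast ν 0 u T) :
    ∀ T' : ℝ, T < T' → ∀ v : ℝ → ℝ³ → ℝ³, ¬ IsKatoSolutionOn T' ν (u 0) v :=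
  not_isKatoSolutionOn_of_not_hasSmoothExtensionPast hν hT hcl hLH hdec hext

/-- **A counterexample has a singular POINT `(T, x₀)`**: the blow-up is localised in space as well
— some `x₀` with `‖u‖_{L^∞(Q_r(T, x₀))} = ∞` for every `0 < r`, `r² < T` (Lemarié-Rieusset 2016
Thm 15.1 (C): far-field bound of Kato solutions + compactness; tree theorem
`exists_singularPoint_of_classical_of_not_hasSmoothExtensionPast`). -/
theorem counterexample_singular_point (hν : 0 < ν) (hT : 0 < T)
    (hcl : IsClassicalNSSolutionOn (Ico 0 T) ν 0 u p) (hLH : IsLerayHopfOn T ν 0 (u 0) u)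
    (hdec : HasRapidSpatialDecay (u 0)) (hext : ¬ HasSmoothExtensionPast ν 0 u T) :
    ∃ x₀ : ℝ³, ∀ r : ℝ, 0 < r → r ^ 2 < T →
      eLpNorm (uncurry u) ⊤ (volume.restrict (parabolicCylinder r ((T : ℝ), x₀))) = ⊤ :=
  exists_singularPoint_of_classical_of_not_hasSmoothExtensionPast hν hT hcl hLH hdec hext

/-- **A.e.-to-everywhere upgrade**: a classical Leray–Hopf solution from a rapidly decaying datum
is bounded POINTWISE on every earlier closed slab `[0, T'] × ℝ³`, `T' < T` (the essential bound
of `counterexample_bounded_before` on a slightly larger slab, plus joint continuity: a value above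
the essential bound would persist on an open box of positive measure inside that slab). This is
exactly the sub-slab hypothesis `hbdd` of the tree's `knss_no_axisymmetric_typeI`. -/
theorem pointwise_bounded_before (hν : 0 < ν)
    (hcl : IsClassicalNSSolutionOn (Ico 0 T) ν 0 u p) (hLH : IsLerayHopfOn T ν 0 (u 0) u)
    (hdec : HasRapidSpatialDecay (u 0)) :
    ∀ T' < T, ∃ M : ℝ, ∀ t ∈ Icc 0 T', ∀ x, ‖u t x‖ ≤ M := by
  intro T' hT'T
  rcases lt_or_ge T' 0 with hneg | hT'0
  · exact ⟨0, fun t ht _ => absurd (ht.1.trans ht.2) (not_le.2 hneg)⟩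
  -- an intermediate time `T' < T'' < T`
  set T'' : ℝ := (T' + T) / 2 with hT''
  have hT'T'' : T' < T'' := by rw [hT'']; linarith
  have hT''T : T'' < T := by rw [hT'']; linarith
  have hT''pos : 0 < T'' := lt_of_le_of_lt hT'0 hT'T''
  -- the a.e. bound on the slab `[0, T''] × ℝ³`
  have hfin := counterexample_bounded_before hν hcl hLH hdec T'' ⟨hT''pos, hT''T⟩
  rw [eLpNorm_exponent_top] at hfin
  set A : Set (ℝ × ℝ³) := Icc 0 T'' ×ˢ univ with hA
  set S := eLpNormEssSup (uncurry u) ((volume : Measure (ℝ × ℝ³)).restrict A) with hS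
  have hae : ∀ᵐ z ∂((volume : Measure (ℝ × ℝ³)).restrict A), ‖uncurry u z‖ₑ ≤ S :=
    enorm_ae_le_eLpNormEssSup _ _
  set K : ℝ := S.toReal with hK
  have hSK : S = ENNReal.ofReal K := (ENNReal.ofReal_toReal hfin.ne).symm
  refine ⟨K, fun t ht x => ?_⟩
  by_contra hKx
  have hKx : K < ‖u t x‖ := not_le.1 hKx
  -- the large value persists on an open box inside the slab
  have hcont : ContinuousOn (uncurry u) (Ico 0 T ×ˢ univ) := hcl.smooth_velocity.continuousOn
  have htT : t < T := (ht.2.trans_lt hT'T'').trans hT''T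
  have hmem : (t, x) ∈ Ico 0 T ×ˢ (univ : Set ℝ³) := mk_mem_prod ⟨ht.1, htT⟩ (mem_univ _)
  have hpre : {z : ℝ × ℝ³ | K < ‖uncurry u z‖} ∈ 𝓝[Ico 0 T ×ˢ univ] ((t, x) : ℝ × ℝ³) :=
    (hcont (t, x) hmem).preimage_mem_nhdsWithin
      ((isOpen_lt continuous_const continuous_norm).mem_nhds hKx)
  obtain ⟨W, hW, hWsub⟩ := mem_nhdsWithin_iff_exists_mem_nhds_inter.1 hpre
  obtain ⟨δ, hδ, hball⟩ := Metric.mem_nhds_iff.1 hW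
  set t₂ : ℝ := min (t + δ) T'' with ht₂
  have htt₂ : t < t₂ := lt_min (by linarith) (ht.2.trans_lt hT'T'')
  set U : Set (ℝ × ℝ³) := Ioo t t₂ ×ˢ ball x δ with hU
  have hUA : U ⊆ A := by
    rintro ⟨s, y⟩ ⟨hs, -⟩
    exact mk_mem_prod ⟨ht.1.trans hs.1.le, hs.2.le.trans (min_le_right _ _)⟩ (mem_univ _)
  have hUmeas : MeasurableSet U := measurableSet_Ioo.prod measurableSet_ball
  have hUpos : (volume : Measure (ℝ × ℝ³)) U ≠ 0 := by
    rw [hU, Measure.volume_eq_prod, Measure.prod_prod]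
    refine (ENNReal.mul_pos ?_ (measure_ball_pos volume x hδ).ne').ne'
    rw [Real.volume_Ioo]
    simp [htt₂]
  have hbig : ∀ z ∈ U, S < ‖uncurry u z‖ₑ := by
    rintro ⟨s, y⟩ ⟨hs, hy⟩
    have hsW : ((s, y) : ℝ × ℝ³) ∈ W := by
      refine hball ?_
      rw [← ball_prod_same]
      refine mk_mem_prod ?_ hy
      rw [Real.ball_eq_Ioo]
      exact ⟨by linarith [hs.1], lt_of_lt_of_le hs.2 (min_le_left _ _)⟩
    have hsS : ((s, y) : ℝ × ℝ³) ∈ Ico 0 T ×ˢ (univ : Set ℝ³) :=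
      mk_mem_prod ⟨ht.1.trans hs.1.le, (hs.2.trans_le (min_le_right _ _)).trans hT''T⟩ (mem_univ _)
    have hKz : K < ‖uncurry u (s, y)‖ := hWsub ⟨hsW, hsS⟩
    rw [hSK, ← ofReal_norm]
    exact (ENNReal.ofReal_lt_ofReal_iff (lt_of_le_of_lt ENNReal.toReal_nonneg hKz)).2 hKz
  exact false_of_ae_le_of_lt_on hae hUA hUmeas hUpos hbig

/-- **The blow-up of a counterexample happens AT `T`**: for every `M` and every `T' < T` there is a
time `t ∈ (T', T) ∩ [0, T)` and a point `x` with `‖u(t, x)‖ > M`, i.e.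
`limsup_{t ↑ T} ‖u(t)‖_∞ = ∞` (`counterexample_unbounded` + `pointwise_bounded_before`). -/
theorem counterexample_blowup_at_T (hν : 0 < ν) (hT : 0 < T)
    (hcl : IsClassicalNSSolutionOn (Ico 0 T) ν 0 u p) (hLH : IsLerayHopfOn T ν 0 (u 0) u)
    (hdec : HasRapidSpatialDecay (u 0)) (hext : ¬ HasSmoothExtensionPast ν 0 u T) :
    ∀ M T' : ℝ, T' < T → ∃ t ∈ Ioo T' T, 0 ≤ t ∧ ∃ x, M < ‖u t x‖ := by
  intro M T' hT'
  set T₀ : ℝ := max ((T' + T) / 2) 0 with hT₀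
  have hT₀T : T₀ < T := max_lt (by linarith) hT
  have hT'T₀ : T' < T₀ := lt_of_lt_of_le (by linarith) (le_max_left _ _)
  obtain ⟨M₀, hM₀⟩ := pointwise_bounded_before hν hcl hLH hdec T₀ hT₀T
  obtain ⟨t, ht, x, hx⟩ := counterexample_unbounded hν hT hcl hLH hext (max M M₀)
  have hMx : M < ‖u t x‖ := lt_of_le_of_lt (le_max_left _ _) hx
  rcases lt_or_ge T₀ t with hlt | hle
  · exact ⟨t, ⟨hT'T₀.trans hlt, ht.2⟩, ht.1, x, hMx⟩
  · exact absurd (hM₀ t ⟨ht.1, hle⟩ x) (not_le.2 (lt_of_le_of_lt (le_max_right _ _) hx))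

/-- **The axisymmetric case of the crux is a theorem of the tree** (Koch–Nadirashvili–Seregin–
Šverák 2009 Thms 6.1–6.2 / Seregin–Šverák 2009 Thm 1.1, discharged as
`knss_no_axisymmetric_typeI_holds`; its sub-slab boundedness hypothesis is
`pointwise_bounded_before`). -/
theorem target_axisymmetric (hν : 0 < ν) (hT : 0 < T)
    (hcl : IsClassicalNSSolutionOn (Ico 0 T) ν 0 u p) (hLH : IsLerayHopfOn T ν 0 (u 0) u)
    (hdec : HasRapidSpatialDecay (u 0)) (hI : IsTypeIBlowup u T)
    (haxi : ∀ t ∈ Ico 0 T, IsAxisymmetric (u t)) : HasSmoothExtensionPast ν 0 u T :=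
  knss_no_axisymmetric_typeI_holds hν hT hcl hLH (pointwise_bounded_before hν hcl hLH hdec) haxi
    (Or.inl hI)

/-- **A counterexample is not axisymmetric** (about the fixed axis of `IsAxisymmetric`; by the
rotation and translation invariance of all clauses, about no axis). -/
theorem counterexample_not_axisymmetric (hν : 0 < ν) (hT : 0 < T)
    (hcl : IsClassicalNSSolutionOn (Ico 0 T) ν 0 u p) (hLH : IsLerayHopfOn T ν 0 (u 0) u)
    (hdec : HasRapidSpatialDecay (u 0)) (hI : IsTypeIBlowup u T)
    (hext : ¬ HasSmoothExtensionPast ν 0 u T) : ¬ ∀ t ∈ Ico 0 T, IsAxisymmetric (u t) :=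
  fun haxi => hext (target_axisymmetric hν hT hcl hLH hdec hI haxi)

/-- … and the axisymmetric case of the provers' local statement `LocalTypeIRegularity` is the
discharged barrier `AxisymmetricTypeIExclusion_holds` (Seregin–Šverák 2009 Thm 3.1). -/
theorem localTypeIRegularity_axisymmetric : AxisymmetricTypeIExclusion :=
  AxisymmetricTypeIExclusion_holds

/-- **Exactly backward self-similar blow-up is excluded** (Leray's 1934 question; Nečas–Růžička–
Šverák 1996, Tsai 1998 Thm 2 — discharged in the tree as `LeraySelfSimilarBlowupExclusion_holds`):
if a solution as in the crux coincides on a final interval `(t₀, T)` with Leray's ansatz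
`(2a(T−t))^{-1/2} U(x/√(2a(T−t)))` for a `C²` profile pair `(U, P)` solving Leray's system, then
`U = 0` (the Leray–Hopf class supplies Tsai's local energy estimates: energy from
`IsLerayHopfOn.lintegral_enorm_sq_le`, dissipation through the classical gradient from
`IsLerayHopfOn.lintegral_frobeniusNormSq_fderiv_of_classical`), so `u` vanishes near `T`, is
bounded on `[0, T)` (`pointwise_bounded_before`) and extends. A counterexample is therefore not
exactly self-similar; the Type-I hypothesis is not even needed. -/
theorem target_selfSimilar (hν : 0 < ν) (hT : 0 < T)
    (hcl : IsClassicalNSSolutionOn (Ico 0 T) ν 0 u p) (hLH : IsLerayHopfOn T ν 0 (u 0) u)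
    (hdec : HasRapidSpatialDecay (u 0)) {a t₀ : ℝ} (ha : 0 < a) (ht₀0 : 0 ≤ t₀) (ht₀ : t₀ < T)
    {U : ℝ³ → ℝ³} {P : ℝ³ → ℝ} (hprof : IsLerayProfile ν a U P)
    (hss : ∀ t ∈ Ioo t₀ T, u t = lerayBackward a T U t) : HasSmoothExtensionPast ν 0 u T := by
  have hU0 : U = 0 := by
    refine LeraySelfSimilarBlowupExclusion_holds.tsai_localEnergy hν ha ht₀ hprof ?_ ?_
    · -- local energy on the unit ball from the global energy bound
      refine ⟨(2 * VectorCalculus.kineticEnergy (u 0)).toNNReal, fun t ht => ?_⟩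
      rw [← hss t ht]
      calc ∫⁻ x in Metric.ball (0 : ℝ³) 1, ‖u t x‖ₑ ^ 2 ≤ ∫⁻ x, ‖u t x‖ₑ ^ 2 :=
            setLIntegral_le_lintegral _ _
        _ ≤ ENNReal.ofReal (2 * VectorCalculus.kineticEnergy (u 0)) :=
            hLH.lintegral_enorm_sq_le hν.le ⟨ht₀0.trans ht.1.le, ht.2.le⟩
        _ = ((2 * VectorCalculus.kineticEnergy (u 0)).toNNReal : ENNReal) := rfl
    · -- local dissipation from the global one, through the classical gradient
      have hglob := (hLH.lintegral_frobeniusNormSq_fderiv_of_classical hcl hT).1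
      refine lt_of_le_of_lt ?_ (lt_top_iff_ne_top.2 hglob)
      calc ∫⁻ t in Ioo t₀ T, ∫⁻ x in Metric.ball (0 : ℝ³) 1,
              ENNReal.ofReal (frobeniusNormSq (fderiv ℝ (lerayBackward a T U t) x))
          = ∫⁻ t in Ioo t₀ T, ∫⁻ x in Metric.ball (0 : ℝ³) 1,
              ENNReal.ofReal (frobeniusNormSq (fderiv ℝ (u t) x)) := by
            refine setLIntegral_congr_fun measurableSet_Ioo (fun t ht => ?_)
            rw [← hss t ht]
        _ ≤ ∫⁻ t in Ioo t₀ T, ∫⁻ x, ENNReal.ofReal (frobeniusNormSq (fderiv ℝ (u t) x)) :=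
            lintegral_mono fun t => setLIntegral_le_lintegral _ _
        _ ≤ ∫⁻ t in Ioo 0 T, ∫⁻ x, ENNReal.ofReal (frobeniusNormSq (fderiv ℝ (u t) x)) :=
            lintegral_mono_set (Ioo_subset_Ioo_left ht₀0)
  -- `u = 0` on `(t₀, T)`; bounded before by `pointwise_bounded_before`
  obtain ⟨M, hM⟩ := pointwise_bounded_before hν hcl hLH hdec ((t₀ + T) / 2) (by linarith)
  refine hasSmoothExtensionPast_of_bounded_holds hν hT hcl hLH ⟨max M 0, fun t ht x => ?_⟩
  rcases le_or_gt t ((t₀ + T) / 2) with hle | hlt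
  · exact (hM t ⟨ht.1, hle⟩ x).trans (le_max_left _ _)
  · have htI : t ∈ Ioo t₀ T := ⟨by linarith, ht.2⟩
    rw [hss t htI, hU0, lerayBackward_apply]
    simp

/-- **`λ`-discretely self-similar blow-up with `λ` near `1` is excluded** (Chae–Wolf 2017 Thm 1.3,
discharged in the tree as `chaeWolf2017_removing_dss_holds`; normal form `ν = 1`, cf. §6): for
every Type-I decay constant `C₀ > 0` there is `c₁ > 1` such that for `1 < c < c₁`, a crux-class
solution which coincides on a final interval `(t₀, T)` with the time-shift of an ancient classical
`c`-DSS solution `w` obeying `‖w(t, x)‖ ≤ C₀ / (‖x‖ + √(-t))` extends past `T` (`w ≡ 0`, so `u`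
vanishes near `T` and is bounded on `[0, T)`). A counterexample modelled on a DSS ancient solution
needs a scaling factor `c ≥ c₁(C₀)` — the open wall `TypeIDSSLiouvilleConjecture`. -/
theorem target_dss_near_one {C₀ : ℝ} (hC₀ : 0 < C₀) :
    ∃ c₁ : ℝ, 1 < c₁ ∧ ∀ c : ℝ, 1 < c → c < c₁ →
      ∀ {T : ℝ} {u : ℝ → ℝ³ → ℝ³} {p : ℝ → ℝ³ → ℝ}, 0 < T →
        IsClassicalNSSolutionOn (Ico 0 T) 1 0 u p → IsLerayHopfOn T 1 0 (u 0) u →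
        HasRapidSpatialDecay (u 0) →
        ∀ {w : ℝ → ℝ³ → ℝ³} {π : ℝ → ℝ³ → ℝ} {t₀ : ℝ}, IsClassicalNSSolutionOn (Iio 0) 1 0 w π →
          IsDiscretelySelfSimilar c w → HasTypeIDecay C₀ w → t₀ < T →
          (∀ t ∈ Ioo t₀ T, ∀ x, u t x = w (t - T) x) → HasSmoothExtensionPast 1 0 u T := by
  obtain ⟨c₁, hc₁, hc⟩ := chaeWolf2017_removing_dss_holds C₀ hC₀
  refine ⟨c₁, hc₁, fun c h1 h2 T u p hT hcl hLH hdec w π t₀ hw hdss hdecay ht₀ hagree => ?_⟩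
  have hw0 : ∀ t < 0, ∀ x, w t x = 0 := hc c h1 h2 w π hw hdss hdecay
  -- `u = 0` on `(t₀, T)`; bounded before
  set T' : ℝ := (max t₀ 0 + T) / 2 with hT'
  have hmax : max t₀ 0 < T := max_lt ht₀ hT
  have hT'T : T' < T := by rw [hT']; linarith
  have ht₀T' : t₀ < T' := by
    have : t₀ ≤ max t₀ 0 := le_max_left _ _
    rw [hT']; linarith
  obtain ⟨M, hM⟩ := pointwise_bounded_before one_pos hcl hLH hdec T' hT'T
  refine hasSmoothExtensionPast_of_bounded_holds one_pos hT hcl hLH ⟨max M 0, fun t ht x => ?_⟩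
  rcases le_or_gt t T' with hle | hlt
  · exact (hM t ⟨ht.1, hle⟩ x).trans (le_max_left _ _)
  · rw [hagree t ⟨ht₀T'.trans hlt, ht.2⟩ x, hw0 (t - T) (by linarith [ht.2]) x, norm_zero]
    exact le_max_right _ _

end Profile


/-! ## §4b What a kill must contain (gen 3; contrapositives of the provers' landed reductions) -/

section Kill

/-- **A counterexample to the crux yields an Albritton–Barker local Type-I singular point**
(`LocalTypeISingularityExists`, the registered OPEN first bullet of A–B 2019 Thm. 1.1: a suitable
weak solution in a parabolic ball whose centre is a backward singular point with
`𝐈 = sup (A + C + D + E) < ∞`). Unconditional: contrapositive of the provers' landed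
`Theorems.noTypeIBlowup_of_not_localTypeISingularityExists` (Morrey bound from the Type-I rate
+ zoom + Lemarié-Rieusset continuation). So a refutation of stmt-1217 settles that open
existence question positively — there is no cheaper kill. -/
theorem localTypeISingularityExists_of_not_target (h : ¬ Target) : LocalTypeISingularityExists := by
  by_contra hno
  exact h (Theorems.noTypeIBlowup_of_not_localTypeISingularityExists hno)

/-- … hence, modulo the vendored forward half of Albritton–Barker 2019 Thm. 1.1
(`AlbrittonBarkerForward`, Seregin–Šverák rescaling), **a counterexample yields a non-trivial
mild bounded ancient solution with `𝐈 < ∞`** (`NontrivialMildAncientTypeIExists`) — the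
Liouville-type object of KNSS 2009. -/
theorem nontrivialMildAncientTypeIExists_of_not_target (hAB : AlbrittonBarkerForward)
    (h : ¬ Target) : NontrivialMildAncientTypeIExists :=
  hAB (localTypeISingularityExists_of_not_target h)

/-- … and, modulo the measurable-slice form of that forward half (hypothesis `hABm` of the
provers' `Theorems.noTypeIBlowup_of_liouvilleConjectureNS`, true for the printed construction),
**a counterexample REFUTES the Liouville conjecture (L) of Koch–Nadirashvili–Seregin–Šverák**
(`LiouvilleConjectureNS`, items stmt-…-0057 / stmt-…-10661): killing this crux is at least as hard
as disproving (L). -/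
theorem not_liouvilleConjectureNS_of_not_target
    (hABm : LocalTypeISingularityExists →
      ∃ (u : ℝ → ℝ³ → ℝ³) (p : ℝ → ℝ³ → ℝ) (G : ℝ → ℝ³ → ℝ³ →L[ℝ] ℝ³),
      (∀ t < 0, AEStronglyMeasurable (u t) volume) ∧
      IsBoundedAncientMildSolution 1 u ∧
      IsSuitableWeakSolutionOn (slab ℝ³ (Iio 0) isOpen_Iio) 1 0 u p ∧
      HasWeakSpatialGradientOn (slab ℝ³ (Iio 0) isOpen_Iio) u G ∧
      ¬ (uncurry u =ᵐ[volume.restrict (Iio (0 : ℝ) ×ˢ (univ : Set ℝ³))] 0) ∧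
      typeIBound (Iio (0 : ℝ) ×ˢ (univ : Set ℝ³)) u p G < ⊤)
    (h : ¬ Target) : ¬ LiouvilleConjectureNS := fun hL =>
  h (Theorems.noTypeIBlowup_of_liouvilleConjectureNS hABm hL)

end Kill

/-! ## §5 `0 < T` is not load-bearing -/

section Tpos

/-- For `T ≤ 0` the conclusion holds for every field: the interval `[0, T)` is empty and the rest
flow on `[0, 1)` is a classical extension. -/
theorem hasSmoothExtensionPast_of_nonpos {ν T : ℝ} (hT : T ≤ 0) (u : ℝ → ℝ³ → ℝ³) :
    HasSmoothExtensionPast ν 0 u T := by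
  refine ⟨1, by linarith, uniformVel (fun _ => 0) e₀,
    uniformPres (derivWithin (fun _ => (0 : ℝ)) (Ico 0 1)) e₀,
    isClassicalNSSolutionOn_uniform (uniqueDiffOn_Ico 0 1) contDiffOn_const ν e₀, fun t ht => ?_⟩
  exact absurd ht.2 (not_lt.2 (hT.trans ht.1))

/-- The crux with the hypothesis `0 < T` DELETED. -/
def TargetWithoutTpos : Prop :=
  ∀ (ν T : ℝ), 0 < ν → ∀ (u : ℝ → ℝ³ → ℝ³) (p : ℝ → ℝ³ → ℝ),
    IsClassicalNSSolutionOn (Set.Ico 0 T) ν 0 u p → IsLerayHopfOn T ν 0 (u 0) u →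
    HasRapidSpatialDecay (u 0) → IsTypeIBlowup u T → HasSmoothExtensionPast ν 0 u T

/-- `0 < T` is decoration: the crux is equivalent to its `T`-unrestricted form. -/
theorem targetWithoutTpos_iff : TargetWithoutTpos ↔ Target := by
  constructor
  · exact fun h ν T hν _ u p hcl hLH hdec hI => h ν T hν u p hcl hLH hdec hI
  · intro h ν T hν u p hcl hLH hdec hI
    rcases le_or_gt T 0 with hT | hT
    · exact hasSmoothExtensionPast_of_nonpos hT u
    · exact h ν T hν hT u p hcl hLH hdec hI

end Tpos

/-! ## §6 Normal form `ν = 1`, `T = 1` (one dimensionless parameter)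

Both symmetries of the problem act on ALL five clauses of the crux and on its conclusion:
the viscosity normalisation `v(s, x) = ν⁻¹ u(s/ν, x)` (Tao 2013, footnote 3) maps
`(ν, T) ↦ (1, νT)` with Type-I constant `C ↦ C/√ν`, and Leray's similarity
`w(s, y) = √T u(T s, √T y)` maps `(1, T) ↦ (1, 1)` keeping the constant. Hence
`target_iff_unit : Target ↔ TargetAt 1 1` — provers may assume `ν = T = 1`, and a counterexample
search has the single parameter `C ≥ c_Leray` (§4). -/

section NormalForm

/-- The crux at fixed viscosity and lifespan. -/
def TargetAt (ν T : ℝ) : Prop :=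
  ∀ (u : ℝ → ℝ³ → ℝ³) (p : ℝ → ℝ³ → ℝ),
    IsClassicalNSSolutionOn (Set.Ico 0 T) ν 0 u p → IsLerayHopfOn T ν 0 (u 0) u →
    HasRapidSpatialDecay (u 0) → IsTypeIBlowup u T → HasSmoothExtensionPast ν 0 u T

theorem target_iff_forall_targetAt : Target ↔ ∀ ν T : ℝ, 0 < ν → 0 < T → TargetAt ν T :=
  Iff.rfl

/-- Rapid decay is preserved by the Navier–Stokes dilation of data `x ↦ c u₀(c x)`, `c > 0`
(chain rule for `iteratedFDeriv` through the linear map `c • id`, and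
`1 + ‖x‖ ≤ max 1 c⁻¹ · (1 + c‖x‖)`). -/
theorem hasRapidSpatialDecay_nsRescaleData {u₀ : ℝ³ → ℝ³} (hu : ContDiff ℝ ∞ u₀)
    (hd : HasRapidSpatialDecay u₀) {c : ℝ} (hc : 0 < c) :
    HasRapidSpatialDecay (nsRescaleData c u₀) := by
  intro n K
  obtain ⟨C, hC⟩ := hd n K
  have hC0 : 0 ≤ C := le_trans (by positivity) (hC 0)
  set m : ℝ := max 1 c⁻¹ with hm
  have hm0 : 0 ≤ m := le_trans zero_le_one (le_max_left _ _)
  refine ⟨m ^ K * (c * c ^ n) * C, fun x => ?_⟩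
  set L : ℝ³ →L[ℝ] ℝ³ := c • ContinuousLinearMap.id ℝ ℝ³ with hL
  have hLx : ∀ y : ℝ³, L y = c • y := fun y => by simp [hL]
  have hfun : nsRescaleData c u₀ = c • (u₀ ∘ ⇑L) := by
    funext y
    simp [nsRescaleData_apply, hLx]
  have hun : ContDiff ℝ n u₀ := hu.of_le (by exact_mod_cast le_top)
  have hcomp : ContDiff ℝ n (u₀ ∘ ⇑L) := hun.comp L.contDiff
  have hnorm_L : ‖L‖ ≤ c := by
    rw [hL]
    calc ‖c • ContinuousLinearMap.id ℝ ℝ³‖ ≤ ‖c‖ * ‖ContinuousLinearMap.id ℝ ℝ³‖ :=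
          (norm_smul c (ContinuousLinearMap.id ℝ ℝ³)).le
      _ ≤ c * 1 := by
          rw [Real.norm_eq_abs, abs_of_pos hc]
          exact mul_le_mul_of_nonneg_left ContinuousLinearMap.norm_id_le hc.le
      _ = c := mul_one c
  -- the derivative of the dilated field
  have hD : ‖iteratedFDeriv ℝ n (nsRescaleData c u₀) x‖ ≤
      c * c ^ n * ‖iteratedFDeriv ℝ n u₀ (L x)‖ := by
    rw [hfun, iteratedFDeriv_const_smul_apply hcomp.contDiffAt, norm_smul, Real.norm_eq_abs,
      abs_of_pos hc, L.iteratedFDeriv_comp_right hun x le_rfl, mul_assoc]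
    refine mul_le_mul_of_nonneg_left ?_ hc.le
    calc ‖(iteratedFDeriv ℝ n u₀ (L x)).compContinuousLinearMap fun _ => L‖
        ≤ ‖iteratedFDeriv ℝ n u₀ (L x)‖ * ∏ _i : Fin n, ‖L‖ :=
          ContinuousMultilinearMap.norm_compContinuousLinearMap_le _ _
      _ ≤ ‖iteratedFDeriv ℝ n u₀ (L x)‖ * c ^ n := by
          rw [Finset.prod_const, Finset.card_univ, Fintype.card_fin]
          exact mul_le_mul_of_nonneg_left (pow_le_pow_left₀ (norm_nonneg _) hnorm_L n) (norm_nonneg _)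
      _ = c ^ n * ‖iteratedFDeriv ℝ n u₀ (L x)‖ := mul_comm _ _
  -- the weight
  have hw : 1 + ‖x‖ ≤ m * (1 + ‖L x‖) := by
    rw [hLx, norm_smul, Real.norm_eq_abs, abs_of_pos hc, mul_add, mul_one]
    have h1 : (1 : ℝ) ≤ m := le_max_left _ _
    have h2 : ‖x‖ ≤ m * (c * ‖x‖) := by
      calc ‖x‖ = c⁻¹ * (c * ‖x‖) := by rw [← mul_assoc, inv_mul_cancel₀ hc.ne', one_mul]
        _ ≤ m * (c * ‖x‖) := mul_le_mul_of_nonneg_right (le_max_right _ _) (by positivity)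
    linarith
  have hwK : (1 + ‖x‖) ^ K ≤ m ^ K * (1 + ‖L x‖) ^ K := by
    rw [← mul_pow]
    exact pow_le_pow_left₀ (by positivity) hw K
  calc (1 + ‖x‖) ^ K * ‖iteratedFDeriv ℝ n (nsRescaleData c u₀) x‖
      ≤ (m ^ K * (1 + ‖L x‖) ^ K) * (c * c ^ n * ‖iteratedFDeriv ℝ n u₀ (L x)‖) :=
        mul_le_mul hwK hD (norm_nonneg _) (by positivity)
    _ = m ^ K * (c * c ^ n) * ((1 + ‖L x‖) ^ K * ‖iteratedFDeriv ℝ n u₀ (L x)‖) := by ring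
    _ ≤ m ^ K * (c * c ^ n) * C := mul_le_mul_of_nonneg_left (hC (L x)) (by positivity)

/-- An affine increasing reparametrisation of time maps left neighbourhoods to left neighbourhoods. -/
theorem tendsto_const_mul_nhdsLT {a T : ℝ} (ha : 0 < a) :
    Tendsto (fun s : ℝ => a * s) (𝓝[<] (a⁻¹ * T)) (𝓝[<] T) := by
  refine tendsto_nhdsWithin_iff.2 ⟨?_, ?_⟩
  · have h : Tendsto (fun s : ℝ => a * s) (𝓝 (a⁻¹ * T)) (𝓝 (a * (a⁻¹ * T))) :=
      (continuous_const.mul continuous_id).tendsto _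
    rw [← mul_assoc, mul_inv_cancel₀ ha.ne', one_mul] at h
    exact h.mono_left nhdsWithin_le_nhds
  · filter_upwards [self_mem_nhdsWithin] with s hs
    have hs' : s < a⁻¹ * T := hs
    show a * s < T
    calc a * s < a * (a⁻¹ * T) := mul_lt_mul_of_pos_left hs' ha
      _ = T := by rw [← mul_assoc, mul_inv_cancel₀ ha.ne', one_mul]

/-- **Viscosity normalisation**: the crux at viscosity `1` (all lifespans) gives the crux at every
viscosity. Type-I constants transform as `C ↦ C/√ν`. -/
theorem targetAt_of_viscosity_one (h1 : ∀ T : ℝ, 0 < T → TargetAt 1 T) {ν T : ℝ} (hν : 0 < ν)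
    (hT : 0 < T) : TargetAt ν T := by
  intro u p hcl hLH hdec hI
  have hν0 : ν ≠ 0 := hν.ne'
  have hνi : 0 < ν⁻¹ := inv_pos.2 hν
  have hνT : 0 < ν * T := mul_pos hν hT
  set v : ℝ → ℝ³ → ℝ³ := timeRescale ν⁻¹ ν⁻¹ u with hv
  set π : ℝ → ℝ³ → ℝ := timeRescale ν⁻¹ (ν⁻¹ ^ 2) p with hπ
  have hmaps : MapsTo (fun s => ν⁻¹ * s) (Ico 0 (ν * T)) (Ico 0 T) := by
    intro s hs
    refine ⟨mul_nonneg hνi.le hs.1, ?_⟩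
    calc ν⁻¹ * s < ν⁻¹ * (ν * T) := mul_lt_mul_of_pos_left hs.2 hνi
      _ = T := by rw [← mul_assoc, inv_mul_cancel₀ hν0, one_mul]
  -- (1) classical at viscosity 1 on `[0, νT)`
  have hclv : IsClassicalNSSolutionOn (Ico 0 (ν * T)) 1 0 v π := by
    have h := hcl.viscosityRescale_set hν0 hmaps (uniqueDiffOn_Ico 0 (ν * T))
    rwa [timeRescale_zero_force] at h
  -- (2) Leray–Hopf
  have hv0 : ν⁻¹ • u 0 = v 0 := by
    funext x
    simp [hv]
  have hLHv : IsLerayHopfOn (ν * T) 1 0 (v 0) v := by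
    have h := hLH.viscosityRescale hνi
    have e1 : T / ν⁻¹ = ν * T := by rw [div_inv_eq_mul, mul_comm]
    rwa [e1, inv_mul_cancel₀ hν0, timeRescale_zero_force, hv0] at h
  -- (3) decay of the datum
  have hdecv : HasRapidSpatialDecay (v 0) := by
    rw [← hv0]
    exact SereginSverak2002_pressureOneSidedBound.hasRapidSpatialDecay_const_smul
      (hcl.contDiff_velocity ⟨le_rfl, hT⟩) hdec ν⁻¹
  -- (4) Type-I with constant `ν⁻¹ C √ν`
  have hIv : IsTypeIBlowup v (ν * T) := by
    obtain ⟨C, hC⟩ := hI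
    refine ⟨ν⁻¹ * C * Real.sqrt ν, ?_⟩
    have ht : Tendsto (fun s : ℝ => ν⁻¹ * s) (𝓝[<] (ν * T)) (𝓝[<] T) := by
      have := tendsto_const_mul_nhdsLT (T := T) hνi
      rwa [inv_inv] at this
    filter_upwards [ht.eventually hC, self_mem_nhdsWithin] with s hs hsT x
    have hsT' : s < ν * T := hsT
    have hpos : 0 < ν * T - s := sub_pos.2 hsT'
    have e : T - ν⁻¹ * s = ν⁻¹ * (ν * T - s) := by field_simp
    have hsq : Real.sqrt (T - ν⁻¹ * s) = (Real.sqrt ν)⁻¹ * Real.sqrt (ν * T - s) := by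
      rw [e, Real.sqrt_mul hνi.le, Real.sqrt_inv]
    have hb := hs x
    show ‖ν⁻¹ • u (ν⁻¹ * s) x‖ ≤ ν⁻¹ * C * Real.sqrt ν / Real.sqrt (ν * T - s)
    rw [norm_smul, Real.norm_eq_abs, abs_of_pos hνi]
    have hsν : 0 < Real.sqrt ν := Real.sqrt_pos.2 hν
    have hsr : 0 < Real.sqrt (ν * T - s) := Real.sqrt_pos.2 hpos
    calc ν⁻¹ * ‖u (ν⁻¹ * s) x‖ ≤ ν⁻¹ * (C / Real.sqrt (T - ν⁻¹ * s)) :=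
          mul_le_mul_of_nonneg_left hb hνi.le
      _ = ν⁻¹ * C * Real.sqrt ν / Real.sqrt (ν * T - s) := by
          rw [hsq]
          field_simp
  -- (5) conclude at viscosity 1 and transport the extension back
  obtain ⟨T₁', hT₁', v', π', hcl', hagree'⟩ := h1 (ν * T) hνT v π hclv hLHv hdecv hIv
  have key := hcl'.stRescale hν one_pos (by rw [mul_one]) 0 0
  have hset : ((fun r => (0 : ℝ) + ν * r) ⁻¹' Ico 0 T₁') = Ico 0 (T₁' / ν) := by
    ext r
    simp only [mem_preimage, zero_add, mem_Ico]
    rw [lt_div_iff₀ hν, mul_comm r ν]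
    constructor
    · rintro ⟨h0, h1⟩; exact ⟨nonneg_of_mul_nonneg_right (by linarith) hν |> fun h => by nlinarith [h0], h1⟩
    · rintro ⟨h0, h1⟩; exact ⟨by positivity, h1⟩
  rw [hset, smul_stPull_zero, show ν * (1 : ℝ) / 1 = ν by simp] at key
  refine ⟨T₁' / ν, by rw [gt_iff_lt, lt_div_iff₀ hν, mul_comm]; exact hT₁', _, _, key, fun t ht => ?_⟩
  funext x
  have hνt : ν * t ∈ Ico 0 (ν * T) := ⟨mul_nonneg hν.le ht.1, mul_lt_mul_of_pos_left ht.2 hν⟩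
  show ν • v' (0 + ν * t) (0 + (1 : ℝ) • x) = u t x
  rw [zero_add, zero_add, one_smul, hagree' (ν * t) hνt]
  show ν • (ν⁻¹ • u (ν⁻¹ * (ν * t)) x) = u t x
  rw [← mul_assoc, inv_mul_cancel₀ hν0, one_mul, smul_smul, mul_inv_cancel₀ hν0, one_smul]

/-- **Time normalisation** (Leray's similarity at fixed viscosity): the crux at `ν = 1`, `T = 1`
gives the crux at `ν = 1` for every lifespan. The Type-I constant is invariant. -/
theorem targetAt_one_of_unit (h11 : TargetAt 1 1) {T : ℝ} (hT : 0 < T) : TargetAt 1 T := by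
  intro u p hcl hLH hdec hI
  set c : ℝ := Real.sqrt T with hc
  have hcpos : 0 < c := Real.sqrt_pos.2 hT
  have hc2 : c ^ 2 = T := Real.sq_sqrt hT.le
  set w : ℝ → ℝ³ → ℝ³ := nsRescale c u with hw
  set ϖ : ℝ → ℝ³ → ℝ := nsRescalePressure c p with hϖ
  -- (1) classical on `[0, 1)`
  have hset : ((fun t => c ^ 2 * t) ⁻¹' Ico 0 T) = Ico 0 1 := by
    ext t
    simp only [mem_preimage, mem_Ico, hc2]
    constructor
    · rintro ⟨h0, h1⟩
      exact ⟨nonneg_of_mul_nonneg_right h0 hT, by nlinarith⟩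
    · rintro ⟨h0, h1⟩
      exact ⟨by positivity, by nlinarith⟩
  have hclw : IsClassicalNSSolutionOn (Ico 0 1) 1 0 w ϖ := by
    have h := IsClassicalNSSolutionOn.nsRescale_holds hcl hcpos
    rwa [hset, nsRescaleForce_zero] at h
  -- (2) Leray–Hopf on `[0, 1)`
  have hw0 : nsRescaleData c (u 0) = w 0 := by
    funext x
    simp [hw, nsRescale_apply, nsRescaleData_apply]
  have hLHw : IsLerayHopfOn 1 1 0 (w 0) w := by
    have h := IsLerayHopfOn.nsRescale_holds hLH hcpos
    rwa [hc2, div_self hT.ne', nsRescaleForce_zero, hw0] at h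
  -- (3) decay
  have hdecw : HasRapidSpatialDecay (w 0) := by
    rw [← hw0]
    exact hasRapidSpatialDecay_nsRescaleData (hcl.contDiff_velocity ⟨le_rfl, hT⟩) hdec hcpos
  -- (4) Type-I, same constant
  have hIw : IsTypeIBlowup w 1 := by
    obtain ⟨C, hC⟩ := hI
    refine ⟨C, ?_⟩
    have ht : Tendsto (fun s : ℝ => c ^ 2 * s) (𝓝[<] 1) (𝓝[<] T) := by
      have := tendsto_const_mul_nhdsLT (T := T) (pow_pos hcpos 2)
      rw [hc2, inv_mul_cancel₀ hT.ne'] at this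
      rwa [hc2]
    filter_upwards [ht.eventually hC, self_mem_nhdsWithin] with s hs hs1 x
    have hs1' : s < 1 := hs1
    have hpos : 0 < 1 - s := sub_pos.2 hs1'
    have hb := hs (c • x)
    show ‖c • u (c ^ 2 * s) (c • x)‖ ≤ C / Real.sqrt (1 - s)
    rw [norm_smul, Real.norm_eq_abs, abs_of_pos hcpos]
    have hsq : Real.sqrt (T - c ^ 2 * s) = c * Real.sqrt (1 - s) := by
      rw [hc2, show T - T * s = T * (1 - s) by ring, Real.sqrt_mul hT.le, ← hc]
    have hsr : 0 < Real.sqrt (1 - s) := Real.sqrt_pos.2 hpos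
    calc c * ‖u (c ^ 2 * s) (c • x)‖ ≤ c * (C / Real.sqrt (T - c ^ 2 * s)) :=
          mul_le_mul_of_nonneg_left hb hcpos.le
      _ = C / Real.sqrt (1 - s) := by rw [hsq]; field_simp
  -- (5) conclude and scale the extension back with `c⁻¹`
  obtain ⟨T₂', hT₂', w', ϖ', hcl', hagree'⟩ := h11 w ϖ hclw hLHw hdecw hIw
  have hci : 0 < c⁻¹ := inv_pos.2 hcpos
  have key := IsClassicalNSSolutionOn.nsRescale_holds hcl' hci
  have hset' : ((fun t => c⁻¹ ^ 2 * t) ⁻¹' Ico 0 T₂') = Ico 0 (T * T₂') := by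
    ext t
    simp only [mem_preimage, mem_Ico, inv_pow, hc2]
    rw [← div_eq_inv_mul, le_div_iff₀ hT, div_lt_iff₀ hT, zero_mul, mul_comm T₂' T]
  rw [hset', nsRescaleForce_zero] at key
  refine ⟨T * T₂', by nlinarith, _, _, key, fun t ht => ?_⟩
  funext x
  have hts : c⁻¹ ^ 2 * t ∈ Ico 0 1 := by
    rw [inv_pow, hc2, ← div_eq_inv_mul]
    exact ⟨div_nonneg ht.1 hT.le, (div_lt_one hT).2 ht.2⟩
  show c⁻¹ • w' (c⁻¹ ^ 2 * t) (c⁻¹ • x) = u t x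
  rw [hagree' _ hts]
  show c⁻¹ • (c • u (c ^ 2 * (c⁻¹ ^ 2 * t)) (c • c⁻¹ • x)) = u t x
  rw [smul_smul, smul_smul, inv_mul_cancel₀ hcpos.ne', one_smul, mul_inv_cancel₀ hcpos.ne', one_smul,
    ← mul_assoc, ← mul_pow, mul_inv_cancel₀ hcpos.ne', one_pow, one_mul]

/-- **Normal form.** The crux is equivalent to its instance `ν = 1`, `T = 1`. -/
theorem target_iff_unit : Target ↔ TargetAt 1 1 :=
  ⟨fun h => h 1 1 one_pos one_pos,
    fun h11 _ν _T hν hT => targetAt_of_viscosity_one (fun _T' hT' => targetAt_one_of_unit h11 hT') hν hT⟩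

end NormalForm

/-! ## §6b Normal form 2: the Type-I rate may be assumed on all of `[0, T)` (gen 3) -/

section GlobalRate

variable {ν T : ℝ} {u : ℝ → ℝ³ → ℝ³} {p : ℝ → ℝ³ → ℝ}

/-- The crux with the Type-I hypothesis STRENGTHENED from "eventually as `t ↑ T`" to the whole
life span: `∃ C, ∀ t ∈ [0, T), ∀ x, ‖u(t, x)‖ ≤ C / √(T - t)` (a weaker statement, a priori). -/
def TargetGlobalRate : Prop :=
  ∀ (ν T : ℝ), 0 < ν → 0 < T → ∀ (u : ℝ → ℝ³ → ℝ³) (p : ℝ → ℝ³ → ℝ),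
    IsClassicalNSSolutionOn (Set.Ico 0 T) ν 0 u p → IsLerayHopfOn T ν 0 (u 0) u →
    HasRapidSpatialDecay (u 0) → (∃ C : ℝ, ∀ t ∈ Ico 0 T, ∀ x, ‖u t x‖ ≤ C / Real.sqrt (T - t)) →
    HasSmoothExtensionPast ν 0 u T

/-- **An eventual Type-I rate is a global one** for crux-class solutions: if
`‖u(t, x)‖ ≤ C/√(T - t)` for `t ∈ (T₁, T)` then, `u` being pointwise bounded by some `M` on
`[0, T'] × ℝ³` for a `T' ∈ (T₁, T)` (§4 `pointwise_bounded_before`) and `√(T - t) ≤ √T` there,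
the rate holds on all of `[0, T)` with constant `max C (M √T)`. -/
theorem globalRate_of_isTypeIBlowup (hν : 0 < ν) (hT : 0 < T)
    (hcl : IsClassicalNSSolutionOn (Ico 0 T) ν 0 u p) (hLH : IsLerayHopfOn T ν 0 (u 0) u)
    (hdec : HasRapidSpatialDecay (u 0)) (hI : IsTypeIBlowup u T) :
    ∃ C : ℝ, ∀ t ∈ Ico 0 T, ∀ x, ‖u t x‖ ≤ C / Real.sqrt (T - t) := by
  obtain ⟨C, hC⟩ := hI
  obtain ⟨T₁, hT₁T, hT₁⟩ := mem_nhdsLT_iff_exists_Ioo_subset.1 hC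
  have hT₁T' : T₁ < T := hT₁T
  set T' : ℝ := max ((T₁ + T) / 2) 0 with hT'
  have hT'T : T' < T := max_lt (by linarith) hT
  have hT₁T' : T₁ < T' := lt_of_lt_of_le (by linarith) (le_max_left _ _)
  obtain ⟨M, hM⟩ := pointwise_bounded_before hν hcl hLH hdec T' hT'T
  refine ⟨max C (M * Real.sqrt T), fun t ht x => ?_⟩
  have hpos : 0 < Real.sqrt (T - t) := Real.sqrt_pos.2 (sub_pos.2 ht.2)
  rcases le_or_gt t T' with hle | hlt
  · -- early times: `‖u‖ ≤ M ≤ M √T / √(T - t)`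
    have hb := hM t ⟨ht.1, hle⟩ x
    have hM0 : 0 ≤ M := (norm_nonneg _).trans hb
    have hsq : Real.sqrt (T - t) ≤ Real.sqrt T := Real.sqrt_le_sqrt (by linarith [ht.1])
    calc ‖u t x‖ ≤ M := hb
      _ ≤ M * Real.sqrt T / Real.sqrt (T - t) := by
          rw [le_div_iff₀ hpos]
          exact mul_le_mul_of_nonneg_left hsq hM0
      _ ≤ max C (M * Real.sqrt T) / Real.sqrt (T - t) :=
          div_le_div_of_nonneg_right (le_max_right _ _) hpos.le
  · -- late times: the eventual rate
    calc ‖u t x‖ ≤ C / Real.sqrt (T - t) := hT₁ ⟨hT₁T'.trans hlt, ht.2⟩ x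
      _ ≤ max C (M * Real.sqrt T) / Real.sqrt (T - t) :=
          div_le_div_of_nonneg_right (le_max_left _ _) hpos.le

/-- **Normal form: the Type-I rate may be assumed on the whole life span.** The crux is
equivalent to its version with the rate hypothesis on all of `[0, T)`; provers may start from
`∀ t ∈ [0, T), ‖u(t)‖_∞ ≤ C/√(T - t)` (and, by §6, from `ν = T = 1`). -/
theorem target_iff_globalRate : Target ↔ TargetGlobalRate := by
  constructor
  · intro h ν T hν hT u p hcl hLH hdec hC
    obtain ⟨C, hC⟩ := hC
    refine h ν T hν hT u p hcl hLH hdec ⟨C, ?_⟩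
    filter_upwards [Ioo_mem_nhdsLT hT] with t ht x using hC t ⟨ht.1.le, ht.2⟩ x
  · intro h ν T hν hT u p hcl hLH hdec hI
    exact h ν T hν hT u p hcl hLH hdec (globalRate_of_isTypeIBlowup hν hT hcl hLH hdec hI)

end GlobalRate


/-! ## §6c The adversary's normal form: what a kill IS (gen 3) -/

section KillNormalForm

/-- **Refutation criterion in normal form.** The crux is FALSE iff there is a classical solution
`(u, p)` of unit-viscosity unforced Navier–Stokes on `[0, 1) × ℝ³`, Leray–Hopf on `[0, 1]` from
its rapidly decaying datum `u 0`, obeying the Type-I rate `‖u(t, x)‖ ≤ C/√(1 - t)` for ALL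
`t ∈ [0, 1)` (not just eventually), with NO classical extension past `1` (`target_iff_unit` +
`globalRate_of_isTypeIBlowup`). By §4 such a `u` is then the maximal Kato solution from `u 0`,
has a singular point `(1, x₀)`, is not axisymmetric / backward self-similar / near-1-DSS-modelled,
its constant satisfies `C ≥ c_Leray` (`counterexample_typeI_constant_ge`), and it yields an
Albritton–Barker local Type-I singular point (§4b). -/
theorem not_target_iff_unit_witness :
    ¬ Target ↔ ∃ (u : ℝ → ℝ³ → ℝ³) (p : ℝ → ℝ³ → ℝ),
      IsClassicalNSSolutionOn (Ico 0 1) 1 0 u p ∧ IsLerayHopfOn 1 1 0 (u 0) u ∧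
      HasRapidSpatialDecay (u 0) ∧ (∃ C : ℝ, ∀ t ∈ Ico (0 : ℝ) 1, ∀ x, ‖u t x‖ ≤ C / Real.sqrt (1 - t)) ∧
      ¬ HasSmoothExtensionPast 1 0 u 1 := by
  rw [target_iff_unit]
  constructor
  · intro h
    by_contra hno
    refine h fun u p hcl hLH hdec hI => ?_
    by_contra hext
    exact hno ⟨u, p, hcl, hLH, hdec, globalRate_of_isTypeIBlowup one_pos one_pos hcl hLH hdec hI, hext⟩
  · rintro ⟨u, p, hcl, hLH, hdec, ⟨C, hC⟩, hext⟩ h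
    refine hext (h u p hcl hLH hdec ⟨C, ?_⟩)
    filter_upwards [Ioo_mem_nhdsLT (zero_lt_one' ℝ)] with t ht x using hC t ⟨ht.1.le, ht.2⟩ x

end KillNormalForm

/-! ## §7 Model refutation: the Navier–Stokes INEQUALITY analogue of the crux is false
(Scheffer 1985 — the switched field blows up at the Type-I rate; gen 3) -/

section NSI

open Literature.Barriers.NavierStokesRegularity.Scheffer

variable {T ν₀ τ : ℝ} {z : ℝ³} {G : Set ℝ³} {u : ℝ → ℝ³ → ℝ³}

/-- **Scheffer's switched field blows up at the Type-I rate.** On the `j`-th piece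
`[t_j, t_{j+1})` the glued field is `τ^{-j} u(s, y)` with `‖u‖ ≤ M` on `[0, T] × ℝ³`, while the
remaining life span is `T₀ - t ≤ T₀ - t_j = τ^{2j} T₀`; hence `√(T₀ - t) ‖𝔲(t, x)‖ ≤ M √T₀` for
every `t < T₀` and every `x` (the field vanishes for `t < 0`): the rate clause `IsTypeIBlowup`
of the crux holds at Scheffer's singular time with constant `M √T₀`. -/
theorem isTypeIBlowup_glue (h : IsNSIBlock T ν₀ τ z G u) :
    IsTypeIBlowup (glue T τ z u) (blowupTime T τ) := by
  obtain ⟨M, hM0, hM⟩ := h.exists_bound_norm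
  refine ⟨M * Real.sqrt (blowupTime T τ), ?_⟩
  filter_upwards [self_mem_nhdsWithin] with t ht x
  have htT : t < blowupTime T τ := ht
  have hpos : 0 < blowupTime T τ - t := sub_pos.2 htT
  have hsq : 0 < Real.sqrt (blowupTime T τ - t) := Real.sqrt_pos.2 hpos
  have hT₀ : 0 ≤ Real.sqrt (blowupTime T τ) := Real.sqrt_nonneg _
  rw [le_div_iff₀ hsq]
  rcases lt_or_ge t 0 with hneg | ht0
  · rw [glue_eq_zero_of_neg h.T_pos h.τ_pos z u hneg]
    simp only [Pi.zero_apply, norm_zero, zero_mul]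
    positivity
  · obtain ⟨j, hj⟩ := exists_mem_Ico_switchTime h.τ_pos h.τ_lt_one ht0 htT
    have hτj : 0 < (τ⁻¹) ^ j := pow_pos (inv_pos.2 h.τ_pos) j
    have hτj' : 0 < τ ^ j := pow_pos h.τ_pos j
    rw [glue_apply_of_mem_Ico h.T_pos h.τ_pos z u hj, norm_smul, Real.norm_eq_abs, abs_of_pos hτj]
    have hs := localTime_mem_Ico (T := T) h.τ_pos hj
    have hb := hM _ (Ico_subset_Icc_self hs)
      ((1 - τ)⁻¹ • z + (τ⁻¹) ^ j • (x - (1 - τ)⁻¹ • z))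
    -- the remaining life span
    have hne : τ ^ 2 ≠ 1 := (pow_lt_one₀ h.τ_pos.le h.τ_lt_one two_ne_zero).ne
    have hrem : blowupTime T τ - t ≤ τ ^ (2 * j) * blowupTime T τ := by
      have e := blowupTime_sub_switchTime T hne j
      linarith [hj.1]
    have hsqrt : Real.sqrt (blowupTime T τ - t) ≤ τ ^ j * Real.sqrt (blowupTime T τ) := by
      calc Real.sqrt (blowupTime T τ - t) ≤ Real.sqrt (τ ^ (2 * j) * blowupTime T τ) :=
            Real.sqrt_le_sqrt hrem
        _ = τ ^ j * Real.sqrt (blowupTime T τ) := by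
            rw [pow_mul, Real.sqrt_mul (pow_nonneg (sq_nonneg τ) j), ← pow_mul, mul_comm 2 j,
              pow_mul, Real.sqrt_sq hτj'.le]
    calc (τ⁻¹) ^ j * ‖u ((τ⁻¹) ^ (2 * j) * (t - switchTime T τ j))
            ((1 - τ)⁻¹ • z + (τ⁻¹) ^ j • (x - (1 - τ)⁻¹ • z))‖ * Real.sqrt (blowupTime T τ - t)
        ≤ (τ⁻¹) ^ j * M * (τ ^ j * Real.sqrt (blowupTime T τ)) := by
          have h1 : (τ⁻¹) ^ j * ‖u ((τ⁻¹) ^ (2 * j) * (t - switchTime T τ j))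
              ((1 - τ)⁻¹ • z + (τ⁻¹) ^ j • (x - (1 - τ)⁻¹ • z))‖ ≤ (τ⁻¹) ^ j * M :=
            mul_le_mul_of_nonneg_left hb hτj.le
          exact mul_le_mul h1 hsqrt hsq.le (by positivity)
      _ = M * Real.sqrt (blowupTime T τ) := by
          rw [inv_pow]
          field_simp

/-- A smooth compactly supported field decays rapidly (each `Dⁿu₀` is continuous with compact
support, so `(1 + |x|)^K |Dⁿu₀(x)|` is bounded). [folklore] -/
theorem hasRapidSpatialDecay_of_hasCompactSupport {u₀ : ℝ³ → ℝ³} (hsm : ContDiff ℝ ∞ u₀)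
    (hc : HasCompactSupport u₀) : HasRapidSpatialDecay u₀ := by
  intro n K
  have hcont : Continuous fun x => (1 + ‖x‖) ^ K * ‖iteratedFDeriv ℝ n u₀ x‖ :=
    ((continuous_const.add continuous_norm).pow K).mul
      (hsm.continuous_iteratedFDeriv (m := n) (mod_cast le_top)).norm
  have hsupp : HasCompactSupport fun x => (1 + ‖x‖) ^ K * ‖iteratedFDeriv ℝ n u₀ x‖ :=
    ((hc.iteratedFDeriv n).norm).mul_left
  obtain ⟨C, hC⟩ := hcont.bounded_above_of_compact_support hsupp
  refine ⟨C, fun x => ?_⟩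
  have h := hC x
  rwa [Real.norm_eq_abs, abs_of_nonneg (by positivity)] at h

/-- The glued field starts from the (smooth, compactly supported) initial slice of the block,
hence from a rapidly decaying datum. -/
theorem hasRapidSpatialDecay_glue_zero (h : IsNSIBlock T ν₀ τ z G u) :
    HasRapidSpatialDecay (glue T τ z u 0) :=
  hasRapidSpatialDecay_of_hasCompactSupport (h.contDiff_glue_slice 0)
    (h.isCompact.of_isClosed_subset (isClosed_tsupport _) (h.tsupport_glue_slice_subset 0))

/-- Every slice of the glued field is smooth with compact support (in `G`). -/
theorem contDiff_hasCompactSupport_glue (h : IsNSIBlock T ν₀ τ z G u) (t : ℝ) :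
    ContDiff ℝ ∞ (glue T τ z u t) ∧ HasCompactSupport (glue T τ z u t) :=
  ⟨h.contDiff_glue_slice t,
    h.isCompact.of_isClosed_subset (isClosed_tsupport _) (h.tsupport_glue_slice_subset t)⟩

/-- **The Navier–Stokes-INEQUALITY analogue of the crux.** Replace "classical solution of NS on
`[0, T)`, Leray–Hopf on `[0, T]`" by "weak solution of the Navier–Stokes inequality on
`ℝ³ × (0, ∞)`" (Scheffer 1985 / Ożański 2020 Def. 1.1, tree `IsWeakNSISolution`: energy class
`sup_t ‖u(t)‖₂ < ∞`, `∇u ∈ L²`, divergence free, the pressure function of `u`, and the LOCAL ENERGY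
INEQUALITY against every nonnegative test — formally `∂ₜu - νΔu + (u·∇)u + ∇p = f`, `f·u ≤ 0`)
with `C^∞` compactly supported slices at all times `t ≥ 0`, keep the rapidly decaying datum and
the Type-I rate at `T`, and weaken the conclusion from "classical extension past `T`" to "every
point `(T, x)` is regular" (essential boundedness on a space–time neighbourhood, CKN). -/
def TargetNSI : Prop :=
  ∀ (ν T : ℝ), 0 < ν → 0 < T → ∀ (u : ℝ → ℝ³ → ℝ³) (p : ℝ → ℝ³ → ℝ),
    IsWeakNSISolution ν u p → (∀ t : ℝ, 0 ≤ t → ContDiff ℝ ∞ (u t) ∧ HasCompactSupport (u t)) →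
    HasRapidSpatialDecay (u 0) → IsTypeIBlowup u T → ∀ x : ℝ³, IsRegularPoint u (T, x)

/-- **Model refutation: the NSI analogue of the crux is FALSE** (Scheffer 1985, Thm. 1.1, in the
tree's sorry-free discharge `NSIBlockExists_holds` + `isWeakNSISolution_glue` +
`not_isRegularPoint_glue`, sharpened by `isTypeIBlowup_glue`): Scheffer's switched field is a
finite-energy weak solution of the Navier–Stokes inequality with smooth compactly supported slices,
from a smooth compactly supported datum, which blows up at `T₀ = T/(1 - τ²)` at the TYPE-I RATE and
is singular at `(T₀, x₀)`. So the energy class, incompressibility, the pressure formula, the local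
energy inequality and the Type-I rate together do NOT give regularity: any proof of the crux must
use the Navier–Stokes EQUATION (`f = 0`) — e.g. the vorticity equation, backward uniqueness,
unique continuation, Liouville theorems for the exact profile equation — or the time-regularity
of classical solutions across `[0, T)` (Scheffer's field jumps down in magnitude at the switching
times `t_j ↑ T₀`), not merely energy-inequality technology (CKN-type ε-regularity holds verbatim for
NSI solutions, Ożański 2020 p. 3, and cannot see the difference). -/
theorem targetNSI_false : ¬ TargetNSI := by
  intro hN
  obtain ⟨T, ν₀, τ, z, G, u, h⟩ := NSIBlockExists_holds
  have hreg := hN ν₀ (blowupTime T τ) h.ν₀_pos h.blowupTime_pos (glue T τ z u)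
    (fun s => normalisedPressure (glue T τ z u s))
    (h.isWeakNSISolution_glue ⟨h.ν₀_pos.le, le_rfl⟩)
    (fun t _ => contDiff_hasCompactSupport_glue h t) (hasRapidSpatialDecay_glue_zero h)
    (isTypeIBlowup_glue h) (blowupPoint τ z)
  exact h.not_isRegularPoint_glue hreg

/-- The same, packaged as an existence statement over the crux's own clauses: **there is a
finite-energy weak NSI solution, smooth and compactly supported at every time, from a rapidly
decaying datum, with a Type-I-rate singular point** (`ν > 0`, `T > 0`). -/
theorem exists_nsi_typeI_singular :
    ∃ (ν T : ℝ) (u : ℝ → ℝ³ → ℝ³) (p : ℝ → ℝ³ → ℝ) (x₀ : ℝ³), 0 < ν ∧ 0 < T ∧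
      IsWeakNSISolution ν u p ∧ (∀ t : ℝ, ContDiff ℝ ∞ (u t) ∧ HasCompactSupport (u t)) ∧
      HasRapidSpatialDecay (u 0) ∧ IsTypeIBlowup u T ∧ ¬ IsRegularPoint u (T, x₀) := by
  obtain ⟨T, ν₀, τ, z, G, u, h⟩ := NSIBlockExists_holds
  exact ⟨ν₀, blowupTime T τ, glue T τ z u, fun s => normalisedPressure (glue T τ z u s),
    blowupPoint τ z, h.ν₀_pos, h.blowupTime_pos, h.isWeakNSISolution_glue ⟨h.ν₀_pos.le, le_rfl⟩,
    fun t => contDiff_hasCompactSupport_glue h t, hasRapidSpatialDecay_glue_zero h,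
    isTypeIBlowup_glue h, h.not_isRegularPoint_glue⟩

end NSI

/-! ## §8 Non-vacuity, and the classical clause fixes the representative (gen 3; gen-1's lost
`target_false_without_classical` re-derived) -/

section Representative

/-- **The hypotheses of the crux are jointly satisfiable (non-vacuity), and then the conclusion
holds**: the rest state `u ≡ 0`, `p ≡ 0` (`ν = T = 1`) is classical on `[0, 1)`, Leray–Hopf from
the rapidly decaying datum `0`, obeys the Type-I rate with constant `0`, and extends (by itself).
Together with §4 (`counterexample_unbounded`): the four hypotheses are met exactly by (i) bounded
solutions, which extend, and (ii) genuine Type-I singularities, whose existence is the open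
question — there is no third, junk, way to satisfy them. -/
theorem target_hypotheses_satisfiable :
    ∃ (ν T : ℝ) (u : ℝ → ℝ³ → ℝ³) (p : ℝ → ℝ³ → ℝ), 0 < ν ∧ 0 < T ∧
      IsClassicalNSSolutionOn (Ico 0 T) ν 0 u p ∧ IsLerayHopfOn T ν 0 (u 0) u ∧
      HasRapidSpatialDecay (u 0) ∧ IsTypeIBlowup u T ∧ HasSmoothExtensionPast ν 0 u T := by
  refine ⟨1, 1, 0, 0, one_pos, one_pos, isClassicalNSSolutionOn_zero _ 1, isLerayHopfOn_zero 1 1,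
    hasRapidSpatialDecay_zero, ⟨0, Eventually.of_forall fun t x => by simp⟩,
    ⟨2, by norm_num, 0, 0, isClassicalNSSolutionOn_zero _ 1, fun t _ => rfl⟩⟩

/-- The spiked rest state: `v(t, x) = e₀` if `0 < t` and `x = 0`, and `0` otherwise — an
a.e.-modification of the rest state on the null line `{x = 0}`, `t > 0`. -/
def spikeVel : ℝ → ℝ³ → ℝ³ := fun t x => if 0 < t ∧ x = 0 then e₀ else 0

/-- The spiked rest state starts from rest. -/
theorem spikeVel_zero : spikeVel 0 = 0 := by
  funext x
  simp [spikeVel]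

/-- Off the line `x = 0` the spiked rest state vanishes. -/
theorem spikeVel_of_ne {t : ℝ} {x : ℝ³} (hx : x ≠ 0) : spikeVel t x = 0 := by
  simp [spikeVel, hx]

/-- On the line `x = 0`, `t > 0`, it equals `e₀`. -/
theorem spikeVel_of_pos {t : ℝ} (ht : 0 < t) : spikeVel t 0 = e₀ := by
  simp [spikeVel, ht]

/-- The spiked rest state is bounded by `1`. -/
theorem norm_spikeVel_le (t : ℝ) (x : ℝ³) : ‖spikeVel t x‖ ≤ 1 := by
  unfold spikeVel
  split_ifs <;> simp

/-- Every slice of the spiked rest state vanishes a.e. -/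
theorem spikeVel_slice_ae_eq (t : ℝ) : spikeVel t =ᵐ[volume] (0 : ℝ³ → ℝ³) := by
  have hsub : {x : ℝ³ | ¬ spikeVel t x = (0 : ℝ³ → ℝ³) x} ⊆ {0} := by
    intro x hx
    by_contra h0
    exact hx (by rw [spikeVel_of_ne h0]; rfl)
  rw [Filter.EventuallyEq, ae_iff]
  exact measure_mono_null hsub (measure_singleton 0)

/-- The spiked rest state vanishes a.e. in space–time. -/
theorem uncurry_spikeVel_ae_eq : uncurry spikeVel =ᵐ[volume] (0 : ℝ × ℝ³ → ℝ³) := by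
  have hsub : {z : ℝ × ℝ³ | ¬ uncurry spikeVel z = (0 : ℝ × ℝ³ → ℝ³) z} ⊆ univ ×ˢ {0} := by
    rintro ⟨t, x⟩ hx
    refine mk_mem_prod (mem_univ _) ?_
    by_contra h0
    exact hx (by simp [uncurry, spikeVel_of_ne h0])
  rw [Filter.EventuallyEq, ae_iff]
  refine measure_mono_null hsub ?_
  rw [Measure.volume_eq_prod, Measure.prod_prod, measure_singleton, mul_zero]

/-- **The spiked rest state is Leray–Hopf from rest** on every `[0, T)`, `T > 0`, for every
viscosity: every clause of `IsLerayHopfOn` sees the slices only through a.e.-stable notions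
(tree: `isLerayHopfOn_zero`, `IsLerayHopfOn.congr_ae_slices`). -/
theorem isLerayHopfOn_spikeVel {T : ℝ} (hT : 0 < T) (ν : ℝ) :
    IsLerayHopfOn T ν 0 (spikeVel 0) spikeVel := by
  rw [spikeVel_zero]
  refine (isLerayHopfOn_zero T ν).congr_ae_slices hT ?_ fun t _ => spikeVel_slice_ae_eq t
  exact (aestronglyMeasurable_const.congr uncurry_spikeVel_ae_eq.symm).restrict

/-- The spiked rest state obeys the Type-I rate at every `T > 0` (it is bounded by `1`, and
`1 ≤ √T / √(T - t)` for `0 ≤ t < T`). -/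
theorem isTypeIBlowup_spikeVel {T : ℝ} (hT : 0 < T) : IsTypeIBlowup spikeVel T := by
  refine ⟨Real.sqrt T, ?_⟩
  filter_upwards [Ioo_mem_nhdsLT hT] with t ht x
  have hpos : 0 < Real.sqrt (T - t) := Real.sqrt_pos.2 (sub_pos.2 ht.2)
  refine (norm_spikeVel_le t x).trans ((one_le_div hpos).2 (Real.sqrt_le_sqrt (by linarith [ht.1])))

/-- **The spiked rest state has no classical extension past any `T > 0`**: an extension would be
a classical field agreeing with `v(T/2, ·)` pointwise, but that slice is discontinuous at `x = 0`. -/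
theorem not_hasSmoothExtensionPast_spikeVel {T : ℝ} (hT : 0 < T) (ν : ℝ) :
    ¬ HasSmoothExtensionPast ν 0 spikeVel T := by
  rintro ⟨T', hT', u', p', hcl, hagree⟩
  have ht₀ : T / 2 ∈ Ico 0 T := ⟨by linarith, by linarith⟩
  have hcont : Continuous (spikeVel (T / 2)) := by
    rw [← hagree (T / 2) ht₀]
    exact (hcl.contDiff_velocity ⟨ht₀.1, ht₀.2.trans hT'⟩).continuous
  -- along `xₙ = (n+1)⁻¹ e₀ → 0` the slice is `0`, at the limit it is `e₀`
  set xs : ℕ → ℝ³ := fun n => (1 / ((n : ℝ) + 1)) • e₀ with hxs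
  have hxs0 : Tendsto xs atTop (𝓝 0) := by
    have h : Tendsto (fun n : ℕ => (1 / ((n : ℝ) + 1)) • e₀) atTop (𝓝 ((0 : ℝ) • e₀)) :=
      (tendsto_one_div_add_atTop_nhds_zero_nat (𝕜 := ℝ)).smul_const e₀
    rwa [zero_smul] at h
  have hne : ∀ n, xs n ≠ 0 := fun n => by
    rw [hxs]
    refine smul_ne_zero (by positivity) ?_
    intro h
    have := norm_e₀
    rw [h, norm_zero] at this
    exact zero_ne_one this
  have hlim : Tendsto (fun n => spikeVel (T / 2) (xs n)) atTop (𝓝 (spikeVel (T / 2) 0)) :=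
    (hcont.tendsto 0).comp hxs0
  have hzero : (fun n => spikeVel (T / 2) (xs n)) = fun _ => 0 := by
    funext n
    exact spikeVel_of_ne (hne n)
  rw [hzero, spikeVel_of_pos (by linarith : 0 < T / 2)] at hlim
  have he : e₀ = 0 := (tendsto_nhds_unique tendsto_const_nhds hlim).symm
  have := norm_e₀
  rw [he, norm_zero] at this
  exact zero_ne_one this

/-- The crux with the classical clause `IsClassicalNSSolutionOn (Ico 0 T) ν 0 u p` DELETED (so the
pressure disappears too): a Leray–Hopf solution from a rapidly decaying datum with the Type-I
rate extends classically. -/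
def TargetWithoutClassical : Prop :=
  ∀ (ν T : ℝ), 0 < ν → 0 < T → ∀ (u : ℝ → ℝ³ → ℝ³),
    IsLerayHopfOn T ν 0 (u 0) u → HasRapidSpatialDecay (u 0) → IsTypeIBlowup u T →
    HasSmoothExtensionPast ν 0 u T

/-- **The classical clause is load-bearing — through the representative.** With
`IsClassicalNSSolutionOn` deleted the statement is FALSE, witnessed by the spiked rest state: it
is Leray–Hopf from the datum `0`, bounded (so Type-I at every `T`), and has no classical extension
since the conclusion `HasSmoothExtensionPast` asks for POINTWISE agreement `u' t = u t` on
`[0, T)`. Classification if it were the crux: refuted-misstated (the Leray–Hopf class consists of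
a.e.-defined objects; repaired statement: conclude `∃` a classical `u'` with `u' t =ᵐ u t`, which
for this witness holds). For provers: any argument run in the weak / mild class (weak–strong
uniqueness, ε-regularity, Kato theory) produces a.e. or `L^∞` information and must be brought
back to the pointwise `u` through the joint continuity supplied by the classical clause — exactly
the step `pointwise_bounded_before` of §4. -/
theorem target_false_without_classical : ¬ TargetWithoutClassical := fun h =>
  not_hasSmoothExtensionPast_spikeVel one_pos 1
    (h 1 1 one_pos one_pos spikeVel (isLerayHopfOn_spikeVel one_pos 1)
      (by rw [spikeVel_zero]; exact hasRapidSpatialDecay_zero) (isTypeIBlowup_spikeVel one_pos))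

end Representative

end Summit.NavierStokesRegularity.NavierStokesRegularity.Cruxes.Target.Disproof
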